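import Literature.Probability.RandomPlanarGeometry.HexSAWLattice
import Literature.Probability.RandomPlanarGeometry.HexSAWTheorem1
import Mathlib.Analysis.SpecialFunctions.Log.Basic
import HarnessLib

/-!
# The Fisher transformation of the hexagonal lattice and `μ(3·12²)`

Grimmett–Li, *Self-avoiding walks and the Fisher transformation* (Electron. J. Combin. 20(3)
(2013) P47), Theorem 1(a): "Let `G` be an infinite, quasi-transitive, connected, cubic graph, and
consider the sequence `(G_k : k = 0, 1, 2, …)` given by `G₀ = G` and `G_{k+1} = F(G_k)`. (a) The
connective constants `μ_k` of the `G_k` satisfy `μ_k⁻¹ = g(μ_{k+1}⁻¹)` where `g(x) = x² + x³`."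
Here `F` is the Fisher transformation (§3: it "acts on `v` by replacing it by a triangle"; `F(G)` is
"the graph obtained from the cubic graph `G` by applying the Fisher transformation at every
vertex"), and `μ = lim σ_n(v)^{1/n}` (§2, eq. (2.1)).

This file proves the case `G = ℍ` (the honeycomb lattice `hvGraph` of `HexSAWLattice.lean`),
`k = 0`: `F(ℍ)` is the Archimedean lattice `(3,12²)` and

* `fisher_relation' : fisherConnectiveConstant⁻¹ ^ 2 + fisherConnectiveConstant⁻¹ ^ 3 =
  hexConnectiveConstant⁻¹`,
* `fisher_relation_sqrt : … = (√(2+√2))⁻¹` (with Duminil-Copin–Smirnov's `μ(ℍ) = √(2+√2)`,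
  `DuminilCopinSmirnov2012_thm1_holds`), `fisherConnectiveConstant_bounds :
  1.711041 < μ(3·12²) < 1.7110414` (the value "μ(𝔸) ≈ 1.711041" printed in Lindorfer 2018,
  Example 2),
* `exists_hasConnectiveConstant_fisher_hvGraph`: the statement in the printed vocabulary — the dart
  model `fisher hvGraph` of `F(ℍ)` has a connective constant `μA` in the sense (2.1) from every
  start, and `μA⁻² + μA⁻³ = (√(2+√2))⁻¹` (`HasConnectiveConstant.eq_fisherConnectiveConstant`:
  `μA` is unique).

Objects: `HV.port u k` (the three neighbours of a honeycomb vertex, indexed so that an edge has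
the same index at both ends), the port model `fisherGraph : SimpleGraph FV`, `FV = HV × Fin 3`
(corner `(u,k)` = the corner of `u`'s triangle on the edge of index `k`), `fisherSawCount`,
`fisherConnectiveConstant` (Fekete), the dart model `fisher G : SimpleGraph G.Dart` for any simple
graph and the isomorphism `FV.fisherIso : fisherGraph ≃g fisher hvGraph`, and
`HasConnectiveConstant G μ` (eq. (2.1), every start).

Proof (§4 of the paper, in an elementary vertex-list form; all machinery `private`). Lower bound
`μ(F) ≥ 1/x` when `x²(1+x) ≥ 1/μ(ℍ)` (`inv_le_fisherConnectiveConstant`): an `n`-step SAW of `ℍ`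
together with a set of inner vertices at which the triangle is circumnavigated the long way lifts
injectively to a SAW of `F(ℍ)` (cf. (4.6), "each triangle may be circumnavigated in either of 2
directions"), whence `Σ_{n≤M} c_n(ℍ) x^{2n-1}(1+x)^{n-1} ≤ 3 Σ_{N≤3M} c_N(F) x^N`. Upper bound
`μ(F) ≤ 1/x` when `x²(1+x) < 1/μ(ℍ)` (`fisherConnectiveConstant_le_inv`, cf. (4.4)): a SAW of
`F(ℍ)` whose first step stays in its triangle re-enters a triangle it has left only at its very
last corner (`stuck`, `good_take_of_not_good`); walks without re-entry project to SAWs of `ℍ`,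
and a first-triangle recursion with avoid-sets plus a truncated generating-function induction
(`gf_goodA_le`) bounds `Σ c_N(F) x^N`. Equality by continuity of `x²(1+x)`.
-/

noncomputable section

open Finset Filter Literature.Probability.LatticeModels
open scoped Topology

namespace Literature.Probability.RandomPlanarGeometry.SAW

/-! ### Ports: the three neighbours of a honeycomb vertex, indexed so that an edge has the same
index at both ends -/

namespace HV

/-- The `k`-th neighbour ("port") of a vertex of the honeycomb lattice `hvGraph`: for an up vertex
`(a, b, false)` the down vertices `(a,b)`, `(a-1,b)`, `(a,b-1)`; for a down vertex `(a, b, true)` the up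
vertices `(a,b)`, `(a+1,b)`, `(a,b+1)`. The edge `{u, port u k}` has index `k` at both ends
(`port_port`). [folklore] -/
def port (u : HV) (k : Fin 3) : HV :=
  match u.2.2, k.val with
  | false, 0 => (u.1, u.2.1, true)
  | false, 1 => (u.1 - 1, u.2.1, true)
  | false, _ => (u.1, u.2.1 - 1, true)
  | true, 0 => (u.1, u.2.1, false)
  | true, 1 => (u.1 + 1, u.2.1, false)
  | true, _ => (u.1, u.2.1 + 1, false)

/-- Crossing an edge twice returns: `port (port u k) k = u`. [folklore] -/
private theorem port_port (u : HV) (k : Fin 3) : port (port u k) k = u := by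
  obtain ⟨a, b, c⟩ := u
  cases c <;> fin_cases k <;> simp [port]

/-- A vertex is adjacent to each of its ports. [folklore] -/
private theorem adj_port (u : HV) (k : Fin 3) : hvGraph.Adj u (port u k) := by
  obtain ⟨a, b, c⟩ := u
  cases c <;> fin_cases k <;> simp [port, hvGraph_adj, AdjRel]

/-- Adjacency is "being a port". [folklore] -/
private theorem adj_iff_exists_port (u v : HV) : hvGraph.Adj u v ↔ ∃ k, v = port u k := by
  constructor
  · intro h
    obtain ⟨a, b, c⟩ := u
    obtain ⟨a', b', c'⟩ := v
    rw [hvGraph_adj, AdjRel] at h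
    cases c <;> cases c' <;> simp at h
    · rcases h with ⟨h1, h2⟩ | ⟨h1, h2⟩ | ⟨h1, h2⟩
      · exact ⟨0, by simp [port, h1, h2]⟩
      · exact ⟨1, by simp [port, h1, h2]⟩
      · exact ⟨2, by simp [port, h1, h2]⟩
    · rcases h with ⟨h1, h2⟩ | ⟨h1, h2⟩ | ⟨h1, h2⟩
      · exact ⟨0, by simp [port, h1, h2]⟩
      · exact ⟨1, by simp [port, h1, h2]⟩
      · exact ⟨2, by simp [port, h1, h2]⟩
  · rintro ⟨k, rfl⟩
    exact adj_port u k

/-- The ports of a vertex are distinct. [folklore] -/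
private theorem port_injective (u : HV) : Function.Injective (port u) := by
  intro k k' h
  obtain ⟨a, b, c⟩ := u
  cases c <;> fin_cases k <;> fin_cases k' <;> simp [port] at h ⊢ <;> omega

/-- A port changes the vertex type. [folklore] -/
private theorem port_ne (u : HV) (k : Fin 3) : port u k ≠ u := by
  obtain ⟨a, b, c⟩ := u
  cases c <;> fin_cases k <;> simp [port]

end HV

/-! ### The Fisher lattice `F(ℍ)`: every honeycomb vertex replaced by a triangle -/

/-- Vertices of the Fisher lattice: corners `(v, k)` = the corner of the triangle at `v` on the edge
of index `k`. [folklore] -/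
abbrev FV : Type := HV × Fin 3

namespace FV

/-- Adjacency in `F(ℍ)`: two corners of one triangle, or the two ends `(v, k)`, `(port v k, k)` of a
connecting (honeycomb) edge. A decidable predicate, not a named fact. [cite: GrimmettLi2013Fisher, §3] -/
def AdjRel (p q : FV) : Prop := (p.1 = q.1 ∧ p.2 ≠ q.2) ∨ (q.1 = HV.port p.1 p.2 ∧ q.2 = p.2)

/-- Symmetry of the adjacency. [folklore] -/
private theorem adjRel_symm {p q : FV} (h : AdjRel p q) : AdjRel q p := by
  rcases h with ⟨h1, h2⟩ | ⟨h1, h2⟩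
  · exact Or.inl ⟨h1.symm, fun h => h2 h.symm⟩
  · right
    refine ⟨?_, h2.symm⟩
    rw [h1, h2, HV.port_port]

/-- Irreflexivity of the adjacency. [folklore] -/
private theorem adjRel_irrefl (p : FV) : ¬ AdjRel p p := by
  rintro (⟨-, h⟩ | ⟨h, -⟩)
  · exact h rfl
  · exact HV.port_ne p.1 p.2 h.symm

/-- The adjacency relation is decidable. [folklore] -/
instance (p q : FV) : Decidable (AdjRel p q) := by unfold AdjRel; infer_instance

end FV

/-- **The Fisher lattice `F(ℍ)`** (the Archimedean lattice `(3,12²)`): the honeycomb lattice with every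
vertex replaced by a triangle (Grimmett–Li 2013, §3: "The so-called Fisher transformation acts on `v`
by replacing it by a triangle"). [cite: GrimmettLi2013Fisher, §3] -/
def fisherGraph : SimpleGraph FV where
  Adj := FV.AdjRel
  symm := ⟨fun _ _ h => FV.adjRel_symm h⟩
  loopless := ⟨fun p h => FV.adjRel_irrefl p h⟩

/-- Adjacency in `fisherGraph`, unfolded. [cite: GrimmettLi2013Fisher, §3] -/
theorem fisherGraph_adj (p q : FV) : fisherGraph.Adj p q ↔ FV.AdjRel p q := Iff.rfl

/-- Adjacency in `fisherGraph` is decidable. [folklore] -/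
instance : DecidableRel fisherGraph.Adj := fun p q =>
  decidable_of_iff _ (fisherGraph_adj p q).symm

/-- The root corner. [folklore] -/
def fRoot : FV := (hvOrigin, 0)

/-! ### Automorphisms: lifting honeycomb automorphisms that respect ports -/

namespace FV

/-- A honeycomb automorphism `φ` permuting the ports by `σ` lifts to `F(ℍ)`. [folklore] -/
private def liftIso (φ : hvGraph ≃g hvGraph) (σ : Equiv.Perm (Fin 3))
    (hφ : ∀ u k, φ (HV.port u k) = HV.port (φ u) (σ k)) : fisherGraph ≃g fisherGraph where
  toEquiv := Equiv.prodCongr φ.toEquiv σ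
  map_rel_iff' := by
    rintro ⟨u, k⟩ ⟨v, k'⟩
    simp only [Equiv.prodCongr_apply, Prod.map, fisherGraph_adj, AdjRel, RelIso.coe_fn_toEquiv]
    constructor
    · rintro (⟨h1, h2⟩ | ⟨h1, h2⟩)
      · exact Or.inl ⟨φ.injective h1, fun h => h2 (by rw [h])⟩
      · right
        have hk : k' = k := σ.injective h2
        subst hk
        refine ⟨φ.injective ?_, rfl⟩
        rw [hφ]; exact h1
    · rintro (⟨h1, h2⟩ | ⟨h1, h2⟩)
      · exact Or.inl ⟨by rw [h1], fun h => h2 (σ.injective h)⟩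
      · right
        subst h2
        exact ⟨by rw [h1, hφ], rfl⟩

/-- `liftIso` in coordinates. [folklore] -/
@[simp] private theorem liftIso_apply (φ : hvGraph ≃g hvGraph) (σ : Equiv.Perm (Fin 3))
    (hφ : ∀ u k, φ (HV.port u k) = HV.port (φ u) (σ k)) (p : FV) :
    liftIso φ σ hφ p = (φ p.1, σ p.2) := rfl

/-- Translations respect ports. [folklore] -/
private theorem shift_port (a b : ℤ) (u : HV) (k : Fin 3) :
    HV.shift a b (HV.port u k) = HV.port (HV.shift a b u) ((Equiv.refl _) k) := by
  obtain ⟨x, y, c⟩ := u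
  cases c <;> fin_cases k <;> simp [HV.port] <;> ring

/-- The central flip respects ports. [folklore] -/
private theorem flip_port (u : HV) (k : Fin 3) :
    HV.flip (HV.port u k) = HV.port (HV.flip u) ((Equiv.refl _) k) := by
  obtain ⟨x, y, c⟩ := u
  cases c <;> fin_cases k <;> simp [HV.port] <;> ring

/-- The rotation by `2π/3` about the centre of the up triangle at the origin, in coordinates:
`(a, b, up) ↦ (-a-b-1, a, up)`, `(a, b, down) ↦ (-a-b-2, a, down)`. [folklore] -/
private def rot : hvGraph ≃g hvGraph where
  toEquiv :=
    { toFun := fun v => (-v.1 - v.2.1 - (if v.2.2 then 2 else 1), v.1, v.2.2)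
      invFun := fun v => (v.2.1, -v.1 - v.2.1 - (if v.2.2 then 2 else 1), v.2.2)
      left_inv := fun v => by obtain ⟨a, b, c⟩ := v; cases c <;> simp <;> ring
      right_inv := fun v => by obtain ⟨a, b, c⟩ := v; cases c <;> simp <;> ring }
  map_rel_iff' := by
    rintro ⟨a, b, c⟩ ⟨a', b', c'⟩
    cases c <;> cases c' <;> simp [hvGraph_adj, HV.AdjRel] <;> omega

/-- `rot` in coordinates. [folklore] -/
@[simp] private theorem rot_apply (v : HV) : rot v = (-v.1 - v.2.1 - (if v.2.2 then 2 else 1), v.1, v.2.2) := rfl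

/-- The cyclic shift `k ↦ k + 1` of the port index. [folklore] -/
private def cyc : Equiv.Perm (Fin 3) := Equiv.addRight 1

/-- `cyc k = k + 1`. [folklore] -/
@[simp] private theorem cyc_apply (k : Fin 3) : cyc k = k + 1 := rfl

/-- The rotation cycles the ports: `rot (port u k) = port (rot u) (k + 1)`. [folklore] -/
private theorem rot_port (u : HV) (k : Fin 3) : rot (HV.port u k) = HV.port (rot u) (cyc k) := by
  obtain ⟨x, y, c⟩ := u
  have h0 : ((0 : Fin 3) + 1 : Fin 3) = 1 := rfl
  have h1 : ((1 : Fin 3) + 1 : Fin 3) = 2 := rfl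
  have h2 : ((2 : Fin 3) + 1 : Fin 3) = 0 := rfl
  cases c <;> fin_cases k <;> simp [HV.port, h0, h1, h2] <;> ring

/-- Lifted translation. [folklore] -/
private def fshift (a b : ℤ) : fisherGraph ≃g fisherGraph := liftIso (HV.shift a b) (Equiv.refl _) (shift_port a b)

/-- Lifted flip. [folklore] -/
private def fflip : fisherGraph ≃g fisherGraph := liftIso HV.flip (Equiv.refl _) flip_port

/-- Lifted rotation (cycles the port index). [folklore] -/
private def frot : fisherGraph ≃g fisherGraph := liftIso rot cyc rot_port

/-- An automorphism of `F(ℍ)` taking `(u, k)` to `(origin, k)`. [folklore] -/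
private def toOriginF (u : HV) : fisherGraph ≃g fisherGraph :=
  if u.2.2 then fflip.trans (fshift u.1 (u.2.1 + 1)) else fshift (-u.1) (-u.2.1)

/-- `toOriginF u` maps `(u, k)` to `(origin, k)`. [folklore] -/
private theorem toOriginF_apply (u : HV) (k : Fin 3) : toOriginF u (u, k) = (hvOrigin, k) := by
  obtain ⟨a, b, c⟩ := u
  cases c <;> simp [toOriginF, fshift, fflip, hvOrigin]

/-- The port-advancing automorphism fixing the origin triangle: rotate, then translate back. [folklore] -/
private def advance : fisherGraph ≃g fisherGraph := frot.trans (fshift 1 0)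

/-- `advance (origin, k) = (origin, k + 1)`. [folklore] -/
private theorem advance_apply (k : Fin 3) : advance (hvOrigin, k) = (hvOrigin, cyc k) := by
  simp [advance, frot, fshift, hvOrigin]

/-- An automorphism of `F(ℍ)` taking the corner `p` to the root `(origin, 0)` (vertex transitivity of
`(3,12²)`). [folklore] -/
private def toRoot (p : FV) : fisherGraph ≃g fisherGraph :=
  if p.2 = 0 then toOriginF p.1
  else if p.2 = 1 then ((toOriginF p.1).trans advance).trans advance
  else (toOriginF p.1).trans advance

/-- `toRoot p p = fRoot`. [folklore] -/
private theorem toRoot_apply_self (p : FV) : toRoot p p = fRoot := by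
  obtain ⟨u, k⟩ := p
  have c1 : cyc 1 = 2 := rfl
  have c2 : cyc 2 = 0 := rfl
  fin_cases k
  · simp only [toRoot, Fin.zero_eta, Fin.isValue, if_true]
    rw [toOriginF_apply]; rfl
  · simp only [toRoot, Fin.mk_one, Fin.isValue]
    rw [if_neg (by decide), if_pos trivial, RelIso.trans_apply, RelIso.trans_apply, toOriginF_apply,
      advance_apply, c1, advance_apply, c2]; rfl
  · simp only [toRoot, Fin.isValue]
    rw [if_neg (by decide), if_neg (by decide), RelIso.trans_apply, toOriginF_apply]
    have : ((⟨2, by norm_num⟩ : Fin 3)) = 2 := rfl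
    rw [this, advance_apply, c2]; rfl

end FV

/-! ### Enumeration of the self-avoiding walks of `F(ℍ)` and the count `c_N(F)` -/

namespace FV

/-- Adjacent corners have honeycomb parts at sup-distance at most one. [folklore] -/
private theorem abs_sub_le_one_of_adj {p q : FV} (h : fisherGraph.Adj p q) :
    |q.1.1 - p.1.1| ≤ 1 ∧ |q.1.2.1 - p.1.2.1| ≤ 1 := by
  rcases h with ⟨h1, -⟩ | ⟨h1, -⟩
  · rw [h1]; simp
  · rw [h1]; exact HV.abs_sub_le_one_of_adj (HV.adj_port p.1 p.2)

/-- The box of corners around `p`. [folklore] -/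
private def box (p : FV) (n : ℕ) : Finset FV := HV.box p.1 n ×ˢ univ

/-- Membership in `box`. [folklore] -/
private theorem mem_box_iff {p : FV} {n : ℕ} {x : FV} :
    x ∈ box p n ↔ |x.1.1 - p.1.1| ≤ n ∧ |x.1.2.1 - p.1.2.1| ≤ n := by
  simp only [box, mem_product, HV.mem_box_iff, mem_univ, and_true]

/-- A chain of adjacent corners stays in the box around its head. [folklore] -/
private theorem mem_box_of_isChain :
    ∀ (l : List FV) (p : FV), (p :: l).IsChain fisherGraph.Adj → ∀ x ∈ p :: l, x ∈ box p l.length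
  | [], p, _, x, hx => by
    simp only [List.mem_singleton] at hx
    subst hx; simp [mem_box_iff]
  | q :: l, p, h, x, hx => by
    rw [List.isChain_cons_cons] at h
    rcases List.mem_cons.1 hx with rfl | hx
    · simp only [mem_box_iff, sub_self, abs_zero, List.length_cons, Nat.cast_add, Nat.cast_one]
      constructor <;> positivity
    · have hq := mem_box_of_isChain l q h.2 x hx
      have h1 := abs_sub_le_one_of_adj h.1
      rw [mem_box_iff] at hq ⊢
      simp only [List.length_cons, Nat.cast_add, Nat.cast_one]
      constructor
      · calc |x.1.1 - p.1.1| = |(x.1.1 - q.1.1) + (q.1.1 - p.1.1)| := by ring_nf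
          _ ≤ |x.1.1 - q.1.1| + |q.1.1 - p.1.1| := abs_add_le _ _
          _ ≤ l.length + 1 := by linarith [hq.1, h1.1]
      · calc |x.1.2.1 - p.1.2.1| = |(x.1.2.1 - q.1.2.1) + (q.1.2.1 - p.1.2.1)| := by ring_nf
          _ ≤ |x.1.2.1 - q.1.2.1| + |q.1.2.1 - p.1.2.1| := abs_add_le _ _
          _ ≤ l.length + 1 := by linarith [hq.2, h1.2]

/-- The finset of `n`-step self-avoiding corner lists of `F(ℍ)` from `p`. [folklore] -/
def sawFin (p : FV) (n : ℕ) : Finset (List FV) :=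
  (listsLen (box p n) (n + 1)).filter fun l => l.IsChain fisherGraph.Adj ∧ l.head? = some p ∧ l.Nodup

/-- `sawFin` enumerates exactly the self-avoiding lists. [folklore] -/
private theorem mem_sawFin_iff {p : FV} {n : ℕ} {l : List FV} :
    l ∈ sawFin p n ↔ l ∈ sawLists fisherGraph p n := by
  rw [sawFin, mem_filter, mem_listsLen_iff, mem_sawLists_iff]
  constructor
  · rintro ⟨⟨hl, -⟩, hc, hh, hn⟩
    exact ⟨hc, hh, hl, hn⟩
  · rintro ⟨hc, hh, hl, hn⟩
    refine ⟨⟨hl, ?_⟩, hc, hh, hn⟩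
    cases l with
    | nil => simp at hl
    | cons q l =>
      simp only [List.head?_cons, Option.some.injEq] at hh
      subst hh
      simp only [List.length_cons, Nat.add_right_cancel_iff] at hl
      rw [← hl]
      exact mem_box_of_isChain l q hc

/-- `sawFin` as a set is `sawLists`. [folklore] -/
private theorem coe_sawFin (p : FV) (n : ℕ) : (sawFin p n : Set (List FV)) = sawLists fisherGraph p n :=
  Set.ext fun _ => mem_sawFin_iff

/-- The number of self-avoiding lists is the cardinality of `sawFin`. [folklore] -/
private theorem ncard_sawLists_eq_card_sawFin (p : FV) (n : ℕ) :
    (sawLists fisherGraph p n).ncard = #(sawFin p n) := by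
  rw [← coe_sawFin, Set.ncard_coe_finset]

/-- The number of `n`-step self-avoiding walks of `F(ℍ)` does not depend on the start. [folklore] -/
private theorem card_sawFin_eq (p : FV) (n : ℕ) : #(sawFin p n) = #(sawFin fRoot n) := by
  rw [← ncard_sawLists_eq_card_sawFin, ← ncard_sawLists_eq_card_sawFin, ← toRoot_apply_self p,
    ncard_sawLists_iso]

end FV

/-- **`c_N(F(ℍ))`**, the number of `N`-step self-avoiding walks of the Fisher lattice `(3,12²)` from a
corner (vertex-transitive: `FV.card_sawFin_eq`). [cite: GrimmettLi2013Fisher, §2 eq. (2.1)] -/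
def fisherSawCount (N : ℕ) : ℕ := #(FV.sawFin fRoot N)

/-- `c_N(F(ℍ))` counts the walks of Mathlib's `sawCount`. [folklore] -/
private theorem fisherSawCount_eq_sawCount (N : ℕ) : fisherSawCount N = sawCount fisherGraph fRoot N := by
  rw [sawCount_eq_ncard_sawLists, FV.ncard_sawLists_eq_card_sawFin, fisherSawCount]

/-! ### Submultiplicativity, positivity, Fekete -/

namespace FV

/-- Splitting map for `c_{m+n} ≤ c_m c_n`. [folklore] -/
private def splitSAW (m : ℕ) (l : List FV) : List FV × List FV :=
  (l.take (m + 1), (l.drop m).map (toRoot (l.getD m fRoot)))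

/-- The two pieces of a split self-avoiding walk are self-avoiding walks from the root. [folklore] -/
private theorem splitSAW_mem {m n : ℕ} {l : List FV} (hl : l ∈ sawLists fisherGraph fRoot (m + n)) :
    (splitSAW m l).1 ∈ sawLists fisherGraph fRoot m ∧
      (splitSAW m l).2 ∈ sawLists fisherGraph fRoot n := by
  obtain ⟨hc, hh, hlen, hnd⟩ := hl
  have hm : m < l.length := by omega
  constructor
  · refine ⟨hc.take _, ?_, ?_, hnd.sublist (List.take_sublist _ _)⟩
    · cases l with
      | nil => simp at hm
      | cons a l => simpa [splitSAW] using hh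
    · simp only [splitSAW, List.length_take]; omega
  · have hd : (l.drop m).head? = some (l.getD m fRoot) := by
      rw [List.head?_drop, List.getD_eq_getElem?_getD, List.getElem?_eq_getElem hm]
      rfl
    have h2 : l.drop m ∈ sawLists fisherGraph (l.getD m fRoot) n :=
      ⟨hc.drop _, hd, by simp only [List.length_drop]; omega, hnd.sublist (List.drop_sublist _ _)⟩
    have := (map_mem_sawLists_iff (toRoot (l.getD m fRoot)) (l := l.drop m) (n := n)
      (v := l.getD m fRoot)).2 h2
    rwa [toRoot_apply_self] at this

/-- Splitting is injective. [folklore] -/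
private theorem splitSAW_injOn (m n : ℕ) :
    Set.InjOn (splitSAW m) (sawLists fisherGraph fRoot (m + n)) := by
  intro l hl l' hl' h
  simp only [splitSAW, Prod.mk.injEq] at h
  obtain ⟨h1, h2⟩ := h
  have hm : m < l.length := by have := hl.2.2.1; omega
  have hm' : m < l'.length := by have := hl'.2.2.1; omega
  have hget : l.getD m fRoot = l'.getD m fRoot := by
    have e1 : (l.take (m + 1))[m]? = l[m]? := by
      rw [List.getElem?_take]; simp
    have e2 : (l'.take (m + 1))[m]? = l'[m]? := by
      rw [List.getElem?_take]; simp
    rw [List.getD_eq_getElem?_getD, List.getD_eq_getElem?_getD, ← e1, ← e2, h1]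
  rw [hget] at h2
  have h3 : l.drop m = l'.drop m := List.map_injective_iff.2 (RelIso.injective _) h2
  have h4 : l.take m = l'.take m := by
    have := congrArg (List.take m) h1
    rwa [List.take_take, List.take_take, min_eq_left (Nat.le_succ m)] at this
  rw [← List.take_append_drop m l, ← List.take_append_drop m l', h3, h4]

end FV

open FV in
/-- **`c_{m+n}(F) ≤ c_m(F) c_n(F)`.** [folklore] -/
private theorem fisherSawCount_add_le (m n : ℕ) : fisherSawCount (m + n) ≤ fisherSawCount m * fisherSawCount n := by
  rw [fisherSawCount, fisherSawCount, fisherSawCount, ← card_product]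
  refine Finset.card_le_card_of_injOn (splitSAW m) ?_ ?_
  · intro l hl
    rw [mem_coe, mem_sawFin_iff] at hl
    rw [mem_coe, mem_product, mem_sawFin_iff, mem_sawFin_iff]
    exact splitSAW_mem hl
  · rw [coe_sawFin]
    exact splitSAW_injOn m n

namespace FV

/-- The lifted zigzag: an infinite self-avoiding path of `F(ℍ)` (the hex zigzag `(0, j, ·)`, each
triangle crossed along one edge): `(0,j,up;0) → (0,j,down;0) → (0,j,down;2) → (0,j+1,up;2) → (0,j+1,up;0) → …`.
[folklore] -/
private def fzig (i : ℕ) : FV :=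
  if i % 4 = 0 then (((0 : ℤ), ((i / 4 : ℕ) : ℤ), false), 0)
  else if i % 4 = 1 then (((0 : ℤ), ((i / 4 : ℕ) : ℤ), true), 0)
  else if i % 4 = 2 then (((0 : ℤ), ((i / 4 : ℕ) : ℤ), true), 2)
  else (((0 : ℤ), ((i / 4 : ℕ) : ℤ) + 1, false), 2)

/-- Consecutive corners of the lifted zigzag are adjacent. [folklore] -/
private theorem fzig_adj (i : ℕ) : fisherGraph.Adj (fzig i) (fzig (i + 1)) := by
  rw [fisherGraph_adj, AdjRel]
  have h4 : i % 4 = 0 ∨ i % 4 = 1 ∨ i % 4 = 2 ∨ i % 4 = 3 := by omega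
  rcases h4 with h | h | h | h
  · have h' : (i + 1) % 4 = 1 := by omega
    have hd : (i + 1) / 4 = i / 4 := by omega
    right
    simp [fzig, h, h', hd, HV.port]
  · have h' : (i + 1) % 4 = 2 := by omega
    have hd : (i + 1) / 4 = i / 4 := by omega
    left
    simp [fzig, h, h', hd]
  · have h' : (i + 1) % 4 = 3 := by omega
    have hd : (i + 1) / 4 = i / 4 := by omega
    right
    simp [fzig, h, h', hd, HV.port]
  · have h' : (i + 1) % 4 = 0 := by omega
    have hd : (i + 1) / 4 = i / 4 + 1 := by omega
    left
    simp [fzig, h, h', hd]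

/-- The lifted zigzag is injective. [folklore] -/
private theorem fzig_injective : Function.Injective fzig := by
  intro i i' h
  have hi : i % 4 = 0 ∨ i % 4 = 1 ∨ i % 4 = 2 ∨ i % 4 = 3 := by omega
  have hi' : i' % 4 = 0 ∨ i' % 4 = 1 ∨ i' % 4 = 2 ∨ i' % 4 = 3 := by omega
  rcases hi with hi | hi | hi | hi <;> rcases hi' with hi' | hi' | hi' | hi' <;>
    simp [fzig, hi, hi'] at h <;> omega

/-- The first `n + 1` corners of the lifted zigzag form an `n`-step self-avoiding walk from the root.
[folklore] -/
private theorem fzig_mem_sawLists (n : ℕ) : (List.range (n + 1)).map fzig ∈ sawLists fisherGraph fRoot n := by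
  refine ⟨?_, ?_, by simp, ?_⟩
  · rw [List.isChain_map]
    exact (List.isChain_range_succ _ _).2 fun i _ => fzig_adj i
  · simp [List.range_succ_eq_map, fzig, fRoot, hvOrigin]
  · exact (List.nodup_range).map fzig_injective

end FV

/-- `c_N(F) ≥ 1`. [folklore] -/
private theorem fisherSawCount_pos (N : ℕ) : 0 < fisherSawCount N := by
  rw [fisherSawCount]
  exact Finset.card_pos.2 ⟨_, FV.mem_sawFin_iff.2 (FV.fzig_mem_sawLists N)⟩

/-- `log c_N(F)` is subadditive. [folklore] -/
private theorem subadditive_log_fisherSawCount : Subadditive fun n => Real.log (fisherSawCount n) := by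
  intro m n
  have hm := fisherSawCount_pos m
  have hn := fisherSawCount_pos n
  rw [← Real.log_mul (by positivity) (by positivity)]
  apply Real.log_le_log (by exact_mod_cast fisherSawCount_pos (m + n))
  exact_mod_cast fisherSawCount_add_le m n

/-- **The connective constant of the Fisher lattice `(3,12²)`**, `μ(F) := lim c_N(F)^{1/N}` (Fekete),
realised as `exp (lim (log c_N)/N)`. [cite: GrimmettLi2013Fisher, §2 eq. (2.1)] -/
def fisherConnectiveConstant : ℝ := Real.exp subadditive_log_fisherSawCount.lim

/-- `μ(F) > 0`. [cite: GrimmettLi2013Fisher, §2 eq. (2.1)] -/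
theorem fisherConnectiveConstant_pos : 0 < fisherConnectiveConstant := Real.exp_pos _

/-- `(log c_N)/N ≥ 0`. [folklore] -/
private theorem bddBelow_log_fisherSawCount_div :
    BddBelow (Set.range fun n : ℕ => Real.log (fisherSawCount n) / n) := by
  refine ⟨0, ?_⟩
  rintro _ ⟨n, rfl⟩
  apply div_nonneg _ (Nat.cast_nonneg n)
  apply Real.log_nonneg
  exact_mod_cast fisherSawCount_pos n

/-- `μ(F)^N ≤ c_N(F)` for every `N`. [cite: GrimmettLi2013Fisher, §2 eq. (2.1)] -/
theorem fisherConnectiveConstant_pow_le (N : ℕ) : fisherConnectiveConstant ^ N ≤ fisherSawCount N := by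
  rcases Nat.eq_zero_or_pos N with rfl | hN
  · rw [pow_zero]; exact_mod_cast fisherSawCount_pos 0
  have h := subadditive_log_fisherSawCount.lim_le_div bddBelow_log_fisherSawCount_div hN.ne'
  rw [fisherConnectiveConstant, ← Real.exp_nat_mul, ← Real.exp_log (x := (fisherSawCount N : ℝ))
    (by exact_mod_cast fisherSawCount_pos N)]
  apply Real.exp_le_exp.2
  rw [le_div_iff₀ (by exact_mod_cast hN)] at h
  linarith

/-- **`c_N(F)^{1/N} → μ(F)`** (Fekete). [cite: GrimmettLi2013Fisher, §2 eq. (2.1)] -/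
theorem tendsto_fisherSawCount_rpow :
    Tendsto (fun n : ℕ => (fisherSawCount n : ℝ) ^ (1 / (n : ℝ))) atTop (𝓝 fisherConnectiveConstant) := by
  have h := subadditive_log_fisherSawCount.tendsto_lim bddBelow_log_fisherSawCount_div
  have h2 := (Real.continuous_exp.tendsto _).comp h
  refine h2.congr' ?_
  filter_upwards [Filter.eventually_gt_atTop 0] with n hn
  simp only [Function.comp_apply]
  rw [Real.rpow_def_of_pos (by exact_mod_cast fisherSawCount_pos n), one_div, ← div_eq_mul_inv]

/-! ### Port indices and the lift of a hexagonal self-avoiding walk -/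

namespace HV

/-- The index of the port of `u` equal to `v` (junk `2` if `v` is not adjacent to `u`). [folklore] -/
def pidx (u v : HV) : Fin 3 := if port u 0 = v then 0 else if port u 1 = v then 1 else 2

/-- `port u (pidx u v) = v` for adjacent `u`, `v`. [folklore] -/
private theorem port_pidx {u v : HV} (h : hvGraph.Adj u v) : port u (pidx u v) = v := by
  obtain ⟨k, rfl⟩ := (adj_iff_exists_port u _).1 h
  unfold pidx
  split_ifs with h0 h1
  · exact h0
  · exact h1
  · fin_cases k
    · exact absurd rfl h0
    · exact absurd rfl h1
    · rfl

/-- `pidx u (port u k) = k`. [folklore] -/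
private theorem pidx_port (u : HV) (k : Fin 3) : pidx u (port u k) = k := by
  have h := port_pidx (adj_port u k)
  exact port_injective u h

/-- The port index of an edge is the same at both ends. [folklore] -/
private theorem pidx_symm {u v : HV} (h : hvGraph.Adj u v) : pidx v u = pidx u v := by
  obtain ⟨k, rfl⟩ := (adj_iff_exists_port u _).1 h
  rw [pidx_port]
  have := pidx_port (port u k) k
  rwa [port_port] at this

/-- The third port index (for `k ≠ k'`, the one different from both). [folklore] -/
private def third (k k' : Fin 3) : Fin 3 := -(k + k')

/-- The third index differs from the two given (distinct) ones. [folklore] -/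
private theorem third_ne {k k' : Fin 3} (h : k ≠ k') : third k k' ≠ k ∧ third k k' ≠ k' := by
  fin_cases k <;> fin_cases k' <;> simp_all [third] <;> decide

end HV

namespace FV

/-- The corners used inside the triangle `v` when the hexagonal walk enters from `prev` and leaves
towards `next`: entry corner, (the third corner if the detour bit `b` is set), exit corner. [folklore] -/
private def block (prev v next : HV) (b : Bool) : List FV :=
  if b then [(v, HV.pidx v prev), (v, HV.third (HV.pidx v prev) (HV.pidx v next)), (v, HV.pidx v next)]
  else [(v, HV.pidx v prev), (v, HV.pidx v next)]

/-- Lift of the hexagonal path `l` entered from `prev`; the detour bits are read from `B` at the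
indices `i, i+1, …`. [folklore] -/
private def liftAux (B : Finset ℕ) : ℕ → HV → List HV → List FV
  | _, _, [] => []
  | _, prev, [v] => [(v, HV.pidx v prev)]
  | i, prev, v :: w :: rest => block prev v w (decide (i ∈ B)) ++ liftAux B (i + 1) v (w :: rest)

/-- **The lift** of a hexagonal walk `v₀ v₁ … vₘ` (`m ≥ 1`) with detour set `B`: the corner of `v₀` on
the edge to `v₁`, then the blocks of `v₁, …, v_{m-1}`, then the entry corner of `vₘ`. [folklore] -/
private def lift (B : Finset ℕ) : List HV → List FV
  | [] => []
  | [v] => [(v, 0)]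
  | v :: w :: rest => (v, HV.pidx v w) :: liftAux B 0 v (w :: rest)

/-- Length of a block. [folklore] -/
private theorem length_block (prev v next : HV) (b : Bool) : (block prev v next b).length = if b then 3 else 2 := by
  unfold block; split_ifs <;> rfl

/-- The first corner of a block is the entry corner. [folklore] -/
private theorem block_eq_cons (prev v next : HV) (b : Bool) :
    ∃ L, block prev v next b = (v, HV.pidx v prev) :: L ∧ (∀ c ∈ L, c.1 = v) ∧
      ((v, HV.pidx v prev) :: L).getLast? = some (v, HV.pidx v next) := by
  unfold block
  split_ifs
  · exact ⟨_, rfl, by simp, rfl⟩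
  · exact ⟨_, rfl, by simp, rfl⟩

/-- `liftAux` of a nonempty path starts at the entry corner. [folklore] -/
private theorem liftAux_eq_cons (B : Finset ℕ) (i : ℕ) (prev v : HV) (rest : List HV) :
    ∃ L, liftAux B i prev (v :: rest) = (v, HV.pidx v prev) :: L := by
  cases rest with
  | nil => exact ⟨[], rfl⟩
  | cons w rest =>
    obtain ⟨L, hL, -, -⟩ := block_eq_cons prev v w (decide (i ∈ B))
    exact ⟨L ++ liftAux B (i + 1) v (w :: rest), by rw [liftAux, hL, List.cons_append]⟩

/-- Every corner of `liftAux B i prev l` lies in a triangle of `l`. [folklore] -/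
private theorem fst_mem_of_mem_liftAux (B : Finset ℕ) :
    ∀ (i : ℕ) (prev : HV) (l : List HV), ∀ c ∈ liftAux B i prev l, c.1 ∈ l
  | _, _, [], c, hc => by simp [liftAux] at hc
  | _, prev, [v], c, hc => by
    simp only [liftAux, List.mem_singleton] at hc
    subst hc; simp
  | i, prev, v :: w :: rest, c, hc => by
    rw [liftAux, List.mem_append] at hc
    rcases hc with hc | hc
    · obtain ⟨L, hL, hLv, -⟩ := block_eq_cons prev v w (decide (i ∈ B))
      rw [hL, List.mem_cons] at hc
      rcases hc with rfl | hc
      · simp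
      · rw [hLv c hc]; simp
    · exact List.mem_cons_of_mem _ (fst_mem_of_mem_liftAux B (i + 1) v (w :: rest) c hc)

/-- The number of detour indices in the window `[i, i + m)`. [folklore] -/
private def bits (B : Finset ℕ) (i m : ℕ) : ℕ := ((Finset.Ico i (i + m)).filter (· ∈ B)).card

/-- Window recursion for `bits`. [folklore] -/
private theorem bits_succ (B : Finset ℕ) (i m : ℕ) :
    bits B i (m + 1) = (if i ∈ B then 1 else 0) + bits B (i + 1) m := by
  unfold bits
  rw [show Finset.Ico i (i + (m + 1)) = insert i (Finset.Ico (i + 1) (i + 1 + m)) by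
    ext j; simp [Finset.mem_Ico]; omega]
  rw [Finset.filter_insert]
  split_ifs with h
  · rw [Finset.card_insert_of_notMem (by simp)]; ring
  · simp

/-- `bits B i 0 = 0`. [folklore] -/
@[simp] private theorem bits_zero (B : Finset ℕ) (i : ℕ) : bits B i 0 = 0 := by simp [bits]

/-- `bits B 0 m = #B` when `B ⊆ {0,…,m-1}`. [folklore] -/
private theorem bits_eq_card {B : Finset ℕ} {m : ℕ} (hB : B ⊆ Finset.range m) : bits B 0 m = B.card := by
  unfold bits
  congr 1
  ext j
  simp only [Finset.mem_filter, Finset.mem_Ico, zero_add, zero_le, true_and]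
  constructor
  · exact fun h => h.2
  · exact fun h => ⟨Finset.mem_range.1 (hB h), h⟩

/-- Length of `liftAux`: two corners per interior triangle plus its detour bit, one for the last.
[folklore] -/
private theorem length_liftAux (B : Finset ℕ) :
    ∀ (i : ℕ) (prev v : HV) (rest : List HV),
      (liftAux B i prev (v :: rest)).length = 2 * rest.length + 1 + bits B i rest.length
  | i, prev, v, [] => by simp [liftAux]
  | i, prev, v, w :: rest => by
    rw [liftAux, List.length_append, length_liftAux B (i + 1) v w rest, length_block, List.length_cons,
      bits_succ]
    simp only [decide_eq_true_eq]
    split_ifs <;> omega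

/-- `liftAux` of a self-avoiding hexagonal path is a self-avoiding chain of corners. [folklore] -/
private theorem liftAux_chain_nodup (B : Finset ℕ) :
    ∀ (i : ℕ) (prev v : HV) (rest : List HV), (prev :: v :: rest).IsChain hvGraph.Adj →
      (prev :: v :: rest).Nodup →
      (liftAux B i prev (v :: rest)).IsChain fisherGraph.Adj ∧ (liftAux B i prev (v :: rest)).Nodup
  | i, prev, v, [], _, _ => by simp [liftAux]
  | i, prev, v, w :: rest, hc, hn => by
    have hc1 : hvGraph.Adj prev v := (List.isChain_cons_cons.1 hc).1
    have hc2 : (v :: w :: rest).IsChain hvGraph.Adj := (List.isChain_cons_cons.1 hc).2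
    have hvw : hvGraph.Adj v w := (List.isChain_cons_cons.1 hc2).1
    have hn2 : (v :: w :: rest).Nodup := (List.nodup_cons.1 hn).2
    have hpw : prev ≠ w := by
      intro h; subst h
      exact (List.nodup_cons.1 hn).1 (by simp)
    obtain ⟨ihc, ihn⟩ := liftAux_chain_nodup B (i + 1) v w rest hc2 hn2
    have hk : HV.pidx v prev ≠ HV.pidx v w := by
      intro h
      have h1 := HV.port_pidx hc1.symm
      have h2 := HV.port_pidx hvw
      rw [h] at h1; exact hpw (h1.symm.trans h2)
    have hthird := HV.third_ne hk
    -- the recursive part starts at the entry corner of `w`, adjacent to the exit corner of `v`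
    obtain ⟨L, hL⟩ := liftAux_eq_cons B (i + 1) v w rest
    have hexit : fisherGraph.Adj (v, HV.pidx v w) (w, HV.pidx w v) :=
      Or.inr ⟨(HV.port_pidx hvw).symm, HV.pidx_symm hvw⟩
    have hvnot : ∀ c ∈ liftAux B (i + 1) v (w :: rest), c.1 ≠ v := by
      intro c hc h
      have := fst_mem_of_mem_liftAux B (i + 1) v (w :: rest) c hc
      rw [h] at this
      exact (List.nodup_cons.1 hn2).1 this
    rw [liftAux]
    rw [hL] at ihc ihn hvnot ⊢
    have hvw_ne : v ≠ w := fun e => (List.nodup_cons.1 hn2).1 (by simp [e])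
    have hvL : ∀ p : Fin 3, (v, p) ∉ L := fun p h => hvnot (v, p) (List.mem_cons_of_mem _ h) rfl
    have ihn' := List.nodup_cons.1 ihn
    by_cases hb : i ∈ B
    · simp only [block, hb, decide_true, if_true, List.cons_append, List.nil_append]
      constructor
      · exact List.IsChain.cons_cons (Or.inl ⟨rfl, hthird.1.symm⟩)
          (List.IsChain.cons_cons (Or.inl ⟨rfl, hthird.2⟩) (List.IsChain.cons_cons hexit ihc))
      · simp only [List.nodup_cons, List.mem_cons, Prod.mk.injEq, true_and, not_or]
        exact ⟨⟨hthird.1.symm, hk, fun h => hvw_ne h.1, hvL _⟩, ⟨hthird.2, fun h => hvw_ne h.1, hvL _⟩,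
          ⟨fun h => hvw_ne h.1, hvL _⟩, ihn'⟩
    · simp only [block, hb, decide_false, Bool.false_eq_true, if_false, List.cons_append, List.nil_append]
      constructor
      · exact List.IsChain.cons_cons (Or.inl ⟨rfl, hk⟩) (List.IsChain.cons_cons hexit ihc)
      · simp only [List.nodup_cons, List.mem_cons, Prod.mk.injEq, true_and, not_or]
        exact ⟨⟨hk, fun h => hvw_ne h.1, hvL _⟩, ⟨fun h => hvw_ne h.1, hvL _⟩, ihn'⟩

/-- **The lift of a hexagonal self-avoiding walk `v₀ … vₘ` (`m = rest.length + 1 ≥ 1`) is a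
self-avoiding walk of `F(ℍ)`** from the corner `(v₀, k)` of the first edge, with
`2m - 1 + #(detours)` steps. [folklore] -/
private theorem lift_mem_sawLists (B : Finset ℕ) {v w : HV} {rest : List HV}
    (hl : (v :: w :: rest) ∈ sawLists hvGraph v (rest.length + 1)) :
    lift B (v :: w :: rest) ∈ sawLists fisherGraph (v, HV.pidx v w)
      (2 * rest.length + 1 + bits B 0 rest.length) := by
  obtain ⟨hc, -, -, hn⟩ := hl
  have hvw : hvGraph.Adj v w := (List.isChain_cons_cons.1 hc).1
  obtain ⟨hc', hn'⟩ := liftAux_chain_nodup B 0 v w rest hc hn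
  obtain ⟨L, hL⟩ := liftAux_eq_cons B 0 v w rest
  have hfirst : fisherGraph.Adj (v, HV.pidx v w) (w, HV.pidx w v) :=
    Or.inr ⟨(HV.port_pidx hvw).symm, HV.pidx_symm hvw⟩
  refine ⟨?_, rfl, ?_, ?_⟩
  · rw [lift, hL]
    rw [hL] at hc'
    exact List.IsChain.cons_cons hfirst hc'
  · rw [lift, List.length_cons, length_liftAux]
  · rw [lift, List.nodup_cons]
    refine ⟨fun h => ?_, hn'⟩
    have := fst_mem_of_mem_liftAux B 0 v (w :: rest) _ h
    exact (List.nodup_cons.1 hn).1 this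

/-- Injectivity of `liftAux` in the path and in the detour bits it reads. [folklore] -/
private theorem liftAux_inj (B B' : Finset ℕ) :
    ∀ (rest rest' : List HV) (i : ℕ) (prev v : HV),
      (prev :: v :: rest).IsChain hvGraph.Adj → (prev :: v :: rest).Nodup →
      (prev :: v :: rest').IsChain hvGraph.Adj → (prev :: v :: rest').Nodup →
      liftAux B i prev (v :: rest) = liftAux B' i prev (v :: rest') →
      rest = rest' ∧ ∀ j, i ≤ j → j < i + rest.length → (j ∈ B ↔ j ∈ B')
  | [], [], _, _, _, _, _, _, _, _ => ⟨rfl, fun j h1 h2 => by simp at h2; omega⟩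
  | [], w' :: rest', i, prev, v, _, _, _, _, h => by
    have := congrArg List.length h
    rw [liftAux, liftAux, List.length_append, length_block, List.length_singleton,
      length_liftAux] at this
    split_ifs at this <;> omega
  | w :: rest, [], i, prev, v, _, _, _, _, h => by
    have := congrArg List.length h
    rw [liftAux, liftAux, List.length_append, length_block, List.length_singleton,
      length_liftAux] at this
    split_ifs at this <;> omega
  | w :: rest, w' :: rest', i, prev, v, hc, hn, hc', hn', h => by
    have hc2 : (v :: w :: rest).IsChain hvGraph.Adj := (List.isChain_cons_cons.1 hc).2
    have hn2 : (v :: w :: rest).Nodup := (List.nodup_cons.1 hn).2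
    have hc2' : (v :: w' :: rest').IsChain hvGraph.Adj := (List.isChain_cons_cons.1 hc').2
    have hn2' : (v :: w' :: rest').Nodup := (List.nodup_cons.1 hn').2
    have hvw : hvGraph.Adj v w := (List.isChain_cons_cons.1 hc2).1
    have hvw' : hvGraph.Adj v w' := (List.isChain_cons_cons.1 hc2').1
    have hwv : w ≠ v := fun e => (List.nodup_cons.1 hn2).1 (by simp [e])
    have hwv' : w' ≠ v := fun e => (List.nodup_cons.1 hn2').1 (by simp [e])
    rw [liftAux, liftAux] at h
    -- the third corner decides the detour bit
    obtain ⟨L, hL⟩ := liftAux_eq_cons B (i + 1) v w rest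
    obtain ⟨L', hL'⟩ := liftAux_eq_cons B' (i + 1) v w' rest'
    have e3 : ∀ (b : Bool) (w₀ : HV) (M : List FV),
        ((block prev v w₀ b ++ (w₀, HV.pidx w₀ v) :: M)[2]?).map Prod.fst = some (if b then v else w₀) := by
      intro b w₀ M
      cases b <;> rfl
    have h3 : ((block prev v w (decide (i ∈ B)) ++ liftAux B (i + 1) v (w :: rest))[2]?).map Prod.fst =
        ((block prev v w' (decide (i ∈ B')) ++ liftAux B' (i + 1) v (w' :: rest'))[2]?).map Prod.fst := by
      rw [h]
    rw [hL, hL', e3, e3] at h3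
    simp only [Option.some.injEq] at h3
    have hb : (i ∈ B ↔ i ∈ B') := by
      by_cases h1 : i ∈ B <;> by_cases h2 : i ∈ B' <;> simp [h1, h2] at h3 ⊢
      · exact hwv' h3.symm
      · exact hwv h3
    have hbd : decide (i ∈ B) = decide (i ∈ B') := by rw [decide_eq_decide]; exact hb
    rw [hbd] at h
    -- the exit corner decides `w`
    have hlen : (block prev v w (decide (i ∈ B'))).length = (block prev v w' (decide (i ∈ B'))).length := by
      rw [length_block, length_block]
    have hblk : block prev v w (decide (i ∈ B')) = block prev v w' (decide (i ∈ B')) :=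
      List.append_inj_left h hlen
    have hww : w = w' := by
      obtain ⟨L₁, h₁, -, hlast₁⟩ := block_eq_cons prev v w (decide (i ∈ B'))
      obtain ⟨L₂, h₂, -, hlast₂⟩ := block_eq_cons prev v w' (decide (i ∈ B'))
      have e := congrArg List.getLast? hblk
      rw [h₁, h₂, hlast₁, hlast₂] at e
      simp only [Option.some.injEq, Prod.mk.injEq, true_and] at e
      rw [← HV.port_pidx hvw, ← HV.port_pidx hvw', e]
    subst hww
    have htail := List.append_cancel_left h
    obtain ⟨hr, hbits⟩ := liftAux_inj B B' rest rest' (i + 1) v w hc2 hn2 hc2' hn2' htail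
    subst hr
    refine ⟨rfl, fun j hj hj2 => ?_⟩
    rcases Nat.eq_or_lt_of_le hj with rfl | hlt
    · exact hb
    · exact hbits j hlt (by simp at hj2 ⊢; omega)

/-- **Injectivity of the lift** on hexagonal self-avoiding walks from a fixed vertex, with detour
sets inside the window of interior vertices. [folklore] -/
private theorem lift_inj {v w w' : HV} {rest rest' : List HV}
    (hl : (v :: w :: rest) ∈ sawLists hvGraph v (rest.length + 1))
    (hl' : (v :: w' :: rest') ∈ sawLists hvGraph v (rest'.length + 1)) {B B' : Finset ℕ}
    (hB : B ⊆ Finset.range rest.length) (hB' : B' ⊆ Finset.range rest'.length)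
    (h : lift B (v :: w :: rest) = lift B' (v :: w' :: rest')) : (w :: rest) = (w' :: rest') ∧ B = B' := by
  obtain ⟨hc, -, -, hn⟩ := hl
  obtain ⟨hc', -, -, hn'⟩ := hl'
  rw [lift, lift] at h
  obtain ⟨h1, h2⟩ := List.cons_eq_cons.1 h
  have hvw : hvGraph.Adj v w := (List.isChain_cons_cons.1 hc).1
  have hvw' : hvGraph.Adj v w' := (List.isChain_cons_cons.1 hc').1
  have hww : w = w' := by
    simp only [Prod.mk.injEq, true_and] at h1
    rw [← HV.port_pidx hvw, ← HV.port_pidx hvw', h1]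
  subst hww
  obtain ⟨hr, hbits⟩ := liftAux_inj B B' rest rest' 0 v w hc hn hc' hn' h2
  subst hr
  refine ⟨rfl, ?_⟩
  ext j
  constructor
  · intro hj
    have := Finset.mem_range.1 (hB hj)
    exact (hbits j (Nat.zero_le _) (by simp; omega)).1 hj
  · intro hj
    have := Finset.mem_range.1 (hB' hj)
    exact (hbits j (Nat.zero_le _) (by simp; omega)).2 hj

end FV

/-! ### The lower bound: `3 Σ_N c_N(F) x^N ≥ Σ_n cₙ(ℍ) x^{2n-1} (1+x)^{n-1}` and `μ(F) ≥ 1/x` whenever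
`x²(1+x) ≥ 1/μ(ℍ)` -/

section Lower

/-- A hexagonal self-avoiding list of length `n + 1 ≥ 2` from `v` is `v :: w :: rest`. [folklore] -/
private theorem exists_cons_cons_of_mem_sawFin {v : HV} {n : ℕ} {l : List HV} (hl : l ∈ HV.sawFin v (n + 1)) :
    ∃ w rest, l = v :: w :: rest ∧ rest.length = n := by
  rw [HV.mem_sawFin_iff] at hl
  obtain ⟨-, hh, hlen, -⟩ := hl
  match l, hh, hlen with
  | a :: b :: rest, hh, hlen =>
    simp only [List.head?_cons, Option.some.injEq] at hh
    subst hh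
    exact ⟨b, rest, rfl, by simpa using hlen⟩

/-- `Σ_{B ⊆ s} y^{#B} = (1 + y)^{#s}`. [folklore] -/
private theorem sum_powerset_pow' (s : Finset ℕ) (y : ℝ) : ∑ B ∈ s.powerset, y ^ B.card = (1 + y) ^ s.card := by
  have := Finset.sum_pow_mul_eq_add_pow y 1 s
  simp only [one_pow, mul_one] at this
  rw [this, add_comm]

/-- The second vertex of a list (junk: the origin). [folklore] -/
private def sec (l : List HV) : HV := (l.drop 1).headD hvOrigin

/-- **Lower-bound counting**: for `0 ≤ x ≤ 1` and every `M`,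
`Σ_{n=1}^{M} cₙ(ℍ) x^{2n-1} (1+x)^{n-1} ≤ 3 · Σ_{N ≤ 3M} c_N(F) x^N` (the lifts with detours are distinct
self-avoiding walks of `F(ℍ)` from the three corners of the root triangle). [folklore] -/
private theorem lower_count (M : ℕ) {x : ℝ} (hx0 : 0 ≤ x) :
    ∑ n ∈ Finset.Icc 1 M, (hexSawCount n : ℝ) * (x ^ (2 * n - 1) * (1 + x) ^ (n - 1)) ≤
      3 * ∑ N ∈ range (3 * M + 1), (fisherSawCount N : ℝ) * x ^ N := by
  classical
  -- parameters: hex length `n`, hex list `l`, detour set `B ⊆ {0,…,n-2}`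
  set D : Finset (Σ _ : ℕ, List HV × Finset ℕ) :=
    (Finset.Icc 1 M).sigma fun n => HV.sawFin hvOrigin n ×ˢ (Finset.range (n - 1)).powerset with hD
  set wt : (Σ _ : ℕ, List HV × Finset ℕ) → ℕ := fun d => 2 * d.1 - 1 + d.2.2.card with hwt
  set key : (Σ _ : ℕ, List HV × Finset ℕ) → Fin 3 × ℕ := fun d => (HV.pidx hvOrigin (sec d.2.1), wt d) with hkey
  -- (1) the left side is the weighted count of the parameters
  have h1 : ∑ n ∈ Finset.Icc 1 M, (hexSawCount n : ℝ) * (x ^ (2 * n - 1) * (1 + x) ^ (n - 1)) =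
      ∑ d ∈ D, x ^ wt d := by
    rw [hD, sum_sigma]
    refine sum_congr rfl fun n hn => ?_
    rw [sum_product]
    simp only [hwt]
    have : ∀ l ∈ HV.sawFin hvOrigin n, ∑ B ∈ (Finset.range (n - 1)).powerset, x ^ (2 * n - 1 + B.card) =
        x ^ (2 * n - 1) * (1 + x) ^ (n - 1) := by
      intro l _
      simp_rw [pow_add]
      rw [← mul_sum, sum_powerset_pow', Finset.card_range]
    rw [sum_congr rfl this, sum_const, nsmul_eq_mul, hexSawCount_eq_card]
  -- (2) the lift maps each key class injectively into `sawFin (origin, k) N`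
  have hmem : ∀ d ∈ D, ∃ w rest, d.2.1 = hvOrigin :: w :: rest ∧ rest.length + 1 = d.1 ∧
      (hvOrigin :: w :: rest) ∈ sawLists hvGraph hvOrigin (rest.length + 1) ∧ d.2.2 ⊆ Finset.range rest.length := by
    rintro ⟨n, l, B⟩ hd
    dsimp only
    rw [hD, mem_sigma, mem_product, Finset.mem_Icc, Finset.mem_powerset] at hd
    obtain ⟨⟨hn1, -⟩, hl, hB⟩ := hd
    dsimp only at hn1 hl hB
    obtain ⟨m, rfl⟩ : ∃ m, n = m + 1 := ⟨n - 1, by omega⟩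
    obtain ⟨w, rest, rfl, hrest⟩ := exists_cons_cons_of_mem_sawFin hl
    refine ⟨w, rest, rfl, by rw [hrest], ?_, by simpa [hrest] using hB⟩
    rw [hrest]; exact HV.mem_sawFin_iff.1 hl
  have hmaps : ∀ d ∈ D, key d ∈ (univ : Finset (Fin 3)) ×ˢ range (3 * M + 1) := by
    rintro ⟨n, l, B⟩ hd
    have hd' := hd
    rw [hD, mem_sigma, mem_product, Finset.mem_Icc, Finset.mem_powerset] at hd'
    obtain ⟨⟨hn1, hnM⟩, -, hB⟩ := hd'
    dsimp only at hn1 hnM hB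
    rw [mem_product, mem_range]
    refine ⟨mem_univ _, ?_⟩
    have := (card_le_card hB).trans_eq (Finset.card_range _)
    show 2 * n - 1 + B.card < 3 * M + 1
    omega
  have hinj : ∀ κ ∈ (univ : Finset (Fin 3)) ×ˢ range (3 * M + 1),
      ((D.filter fun d => key d = κ).card : ℝ) ≤ #(FV.sawFin (hvOrigin, κ.1) κ.2) := by
    rintro ⟨k, N⟩ -
    norm_cast
    refine card_le_card_of_injOn (fun d => FV.lift d.2.2 d.2.1) ?_ ?_
    · intro d hd
      rw [mem_coe, mem_filter] at hd
      obtain ⟨hd, hκ⟩ := hd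
      obtain ⟨w, rest, hl, hrest, hsaw, hB⟩ := hmem d hd
      rw [mem_coe, FV.mem_sawFin_iff]
      show FV.lift d.2.2 d.2.1 ∈ sawLists fisherGraph (hvOrigin, k) N
      have hk : HV.pidx hvOrigin (sec d.2.1) = k := by have := congrArg Prod.fst hκ; exact this
      have hN : wt d = N := by have := congrArg Prod.snd hκ; exact this
      have hlift := FV.lift_mem_sawLists d.2.2 hsaw
      rw [hl]
      have hsec : sec (hvOrigin :: w :: rest) = w := rfl
      rw [hl, hsec] at hk
      rw [hk] at hlift
      convert hlift using 2
      rw [← hN, hwt]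
      show 2 * d.1 - 1 + d.2.2.card = 2 * rest.length + 1 + FV.bits d.2.2 0 rest.length
      rw [FV.bits_eq_card hB]
      omega
    · intro d hd d' hd' h
      rw [mem_coe, mem_filter] at hd hd'
      obtain ⟨w, rest, hl, hrest, hsaw, hB⟩ := hmem d hd.1
      obtain ⟨w', rest', hl', hrest', hsaw', hB'⟩ := hmem d' hd'.1
      have h' : FV.lift d.2.2 d.2.1 = FV.lift d'.2.2 d'.2.1 := h
      rw [hl, hl'] at h'
      obtain ⟨hww, hBB⟩ := FV.lift_inj hsaw hsaw' hB hB' h'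
      obtain ⟨n, l, B⟩ := d
      obtain ⟨n', l', B'⟩ := d'
      dsimp only at hl hl' hrest hrest' hBB hww ⊢
      have hn : n = n' := by
        have := congrArg List.length hww
        simp only [List.length_cons] at this
        omega
      subst hn; subst hBB
      rw [hl, hl', hww]
  -- (3) assemble
  rw [h1, ← sum_fiberwise_of_maps_to hmaps]
  have h3 : ∀ κ ∈ (univ : Finset (Fin 3)) ×ˢ range (3 * M + 1),
      ∑ d ∈ D.filter (fun d => key d = κ), x ^ wt d ≤ (#(FV.sawFin (hvOrigin, κ.1) κ.2) : ℝ) * x ^ κ.2 := by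
    intro κ hκ
    have : ∑ d ∈ D.filter (fun d => key d = κ), x ^ wt d = ∑ _d ∈ D.filter (fun d => key d = κ), x ^ κ.2 := by
      refine sum_congr rfl fun d hd => ?_
      rw [mem_filter] at hd
      rw [← hd.2]
    rw [this, sum_const, nsmul_eq_mul]
    exact mul_le_mul_of_nonneg_right (hinj κ hκ) (pow_nonneg hx0 _)
  refine (sum_le_sum h3).trans (le_of_eq ?_)
  rw [sum_product]
  have h4 : ∀ k : Fin 3, ∑ N ∈ range (3 * M + 1), (#(FV.sawFin (hvOrigin, k) N) : ℝ) * x ^ N =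
      ∑ N ∈ range (3 * M + 1), (fisherSawCount N : ℝ) * x ^ N :=
    fun k => sum_congr rfl fun N _ => by rw [FV.card_sawFin_eq, fisherSawCount]
  simp only [h4, sum_const, Finset.card_univ, Fintype.card_fin, nsmul_eq_mul]
  norm_num

/-- Each lower-bound term is at least `1/(x(1+x))` once `x²(1+x) ≥ 1/μ(ℍ)` (since `cₙ(ℍ) ≥ μ(ℍ)ⁿ`).
[folklore] -/
private theorem lower_term_ge {x : ℝ} (hx0 : 0 < x) (hge : hexConnectiveConstant⁻¹ ≤ x ^ 2 * (1 + x)) {n : ℕ}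
    (hn : 1 ≤ n) : 1 / (x * (1 + x)) ≤ (hexSawCount n : ℝ) * (x ^ (2 * n - 1) * (1 + x) ^ (n - 1)) := by
  have hμ := hexConnectiveConstant_pos
  have h1 : 1 ≤ hexConnectiveConstant * (x ^ 2 * (1 + x)) := by
    have := mul_le_mul_of_nonneg_left hge hμ.le
    rwa [mul_inv_cancel₀ hμ.ne'] at this
  obtain ⟨m, rfl⟩ : ∃ m, n = m + 1 := ⟨n - 1, by omega⟩
  rw [div_le_iff₀ (by positivity)]
  have e : (hexSawCount (m + 1) : ℝ) * (x ^ (2 * (m + 1) - 1) * (1 + x) ^ (m + 1 - 1)) * (x * (1 + x)) =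
      hexSawCount (m + 1) * ((x ^ 2) ^ (m + 1) * (1 + x) ^ (m + 1)) := by
    rw [show 2 * (m + 1) - 1 = 2 * m + 1 by omega, show m + 1 - 1 = m by omega, ← pow_mul]
    ring
  rw [e]
  calc (1 : ℝ) = 1 ^ (m + 1) := by simp
    _ ≤ (hexConnectiveConstant * (x ^ 2 * (1 + x))) ^ (m + 1) := pow_le_pow_left₀ zero_le_one h1 _
    _ = hexConnectiveConstant ^ (m + 1) * ((x ^ 2) ^ (m + 1) * (1 + x) ^ (m + 1)) := by
        rw [mul_pow, mul_pow]
    _ ≤ hexSawCount (m + 1) * ((x ^ 2) ^ (m + 1) * (1 + x) ^ (m + 1)) :=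
        mul_le_mul_of_nonneg_right (hexConnectiveConstant_pow_le _) (by positivity)

/-- **Lower bound** (half of Grimmett–Li 2013, Theorem 1(a), for `G = ℍ`): if `x > 0` and
`x²(1+x) ≥ 1/μ(ℍ)` then `μ(F(ℍ)) ≥ 1/x`; i.e. `μ(F)⁻²(1 + μ(F)⁻¹) ≤ μ(ℍ)⁻¹`-direction of the
Fisher relation `g(μ(F)⁻¹) = μ(ℍ)⁻¹`, `g(y) = y² + y³`. [cite: GrimmettLi2013Fisher, Theorem 1(a), §4 eq. (4.6)] -/
theorem inv_le_fisherConnectiveConstant {x : ℝ} (hx0 : 0 < x)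
    (hge : hexConnectiveConstant⁻¹ ≤ x ^ 2 * (1 + x)) : x⁻¹ ≤ fisherConnectiveConstant := by
  refine le_of_not_gt fun hlt => ?_
  set μF := fisherConnectiveConstant with hμF
  have hμF0 : 0 < μF := fisherConnectiveConstant_pos
  have hμx : μF * x < 1 := by
    have := mul_lt_mul_of_pos_right hlt hx0
    rwa [inv_mul_cancel₀ hx0.ne'] at this
  set ρ := (μF * x + 1) / 2 with hρ
  have hρ1 : ρ < 1 := by rw [hρ]; linarith
  have hρ0 : 0 < ρ := by rw [hρ]; positivity
  have hμρ : μF < ρ / x := by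
    rw [lt_div_iff₀ hx0, hρ]; linarith
  obtain ⟨N₀, hN₀⟩ := eventually_atTop.1 ((tendsto_order.1 tendsto_fisherSawCount_rpow).2 _ hμρ)
  -- tail terms are dominated by `ρ^N`
  have htail : ∀ N, N₀ ≤ N → 1 ≤ N → (fisherSawCount N : ℝ) * x ^ N ≤ ρ ^ N := by
    intro N hN hN1
    have h := hN₀ N hN
    have hc : (0 : ℝ) ≤ fisherSawCount N := Nat.cast_nonneg _
    have h1 : (fisherSawCount N : ℝ) = ((fisherSawCount N : ℝ) ^ (1 / (N : ℝ))) ^ N := by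
      rw [one_div, Real.rpow_inv_natCast_pow hc (by omega)]
    have h2 : ((fisherSawCount N : ℝ) ^ (1 / (N : ℝ))) ^ N ≤ (ρ / x) ^ N :=
      pow_le_pow_left₀ (Real.rpow_nonneg hc _) h.le N
    calc (fisherSawCount N : ℝ) * x ^ N ≤ (ρ / x) ^ N * x ^ N := by
          rw [h1]; exact mul_le_mul_of_nonneg_right h2 (pow_nonneg hx0.le N)
      _ = ρ ^ N := by rw [← mul_pow, div_mul_cancel₀ _ hx0.ne']
  -- uniform bound on the partial sums of `Σ c_N(F) x^N`
  set K := ∑ N ∈ range (N₀ + 1), (fisherSawCount N : ℝ) * x ^ N + 1 / (1 - ρ) with hK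
  have hbound : ∀ M', ∑ N ∈ range M', (fisherSawCount N : ℝ) * x ^ N ≤ K := by
    intro M'
    have hsplit : ∑ N ∈ range M', (fisherSawCount N : ℝ) * x ^ N ≤
        ∑ N ∈ range (N₀ + 1), (fisherSawCount N : ℝ) * x ^ N + ∑ N ∈ range M', ρ ^ N := by
      rw [← sum_filter_add_sum_filter_not (range M') (fun N => N ≤ N₀)]
      refine add_le_add ?_ ?_
      · refine sum_le_sum_of_subset_of_nonneg ?_ fun N _ _ => by positivity
        intro N hN
        rw [mem_filter, mem_range] at hN
        rw [mem_range]; omega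
      · calc ∑ N ∈ (range M').filter (fun N => ¬ N ≤ N₀), (fisherSawCount N : ℝ) * x ^ N
            ≤ ∑ N ∈ (range M').filter (fun N => ¬ N ≤ N₀), ρ ^ N :=
              sum_le_sum fun N hN => by
                rw [mem_filter] at hN
                exact htail N (by omega) (by omega)
          _ ≤ ∑ N ∈ range M', ρ ^ N :=
              sum_le_sum_of_subset_of_nonneg (filter_subset _ _) fun N _ _ => pow_nonneg hρ0.le N
    have hgeom : ∑ N ∈ range M', ρ ^ N ≤ 1 / (1 - ρ) := by
      rw [geom_sum_eq hρ1.ne]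
      have h1ρ : 0 < 1 - ρ := by linarith
      rw [show (ρ ^ M' - 1) / (ρ - 1) = (1 - ρ ^ M') / (1 - ρ) by
        rw [show ρ ^ M' - 1 = -(1 - ρ ^ M') by ring, show ρ - 1 = -(1 - ρ) by ring, neg_div_neg_eq],
        div_le_div_iff_of_pos_right h1ρ]
      linarith [pow_nonneg hρ0.le M']
    linarith
  -- the hexagonal side grows linearly
  have hK0 : 0 ≤ K := le_trans (sum_nonneg fun N _ => by positivity) (hbound (N₀ + 1))
  obtain ⟨M, hM⟩ := exists_nat_gt (3 * K * (x * (1 + x)))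
  have hlow : (M : ℝ) * (1 / (x * (1 + x))) ≤
      ∑ n ∈ Finset.Icc 1 M, (hexSawCount n : ℝ) * (x ^ (2 * n - 1) * (1 + x) ^ (n - 1)) := by
    calc (M : ℝ) * (1 / (x * (1 + x))) = ∑ _n ∈ Finset.Icc 1 M, 1 / (x * (1 + x)) := by
          rw [sum_const, Nat.card_Icc, nsmul_eq_mul]; simp
      _ ≤ _ := sum_le_sum fun n hn => lower_term_ge hx0 hge (Finset.mem_Icc.1 hn).1
  have h := (hlow.trans (lower_count M hx0.le)).trans (mul_le_mul_of_nonneg_left (hbound _) (by norm_num))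
  rw [mul_one_div, div_le_iff₀ (by positivity)] at h
  linarith

end Lower

/-! ### The upper bound, I: good walks avoiding a set of triangles, and their first-block recursion -/

namespace FV

/-- The A-property: the first step (if any) stays inside the starting triangle. A decidable predicate,
not a named fact. [folklore] -/
private def IsA : List FV → Prop
  | p :: q :: _ => q.1 = p.1
  | _ => True

/-- `IsA` is decidable. [folklore] -/
private instance : DecidablePred IsA := fun l => by
  unfold IsA; rcases l with _ | ⟨p, _ | ⟨q, r⟩⟩ <;> infer_instance

/-- The triangle of the `i`-th corner of a list (junk beyond the end). [folklore] -/
private def triAt (π : List FV) (i : ℕ) : HV := (π.getD i fRoot).1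

/-- Goodness: a triangle, once left, is never visited again. A decidable predicate, not a named fact.
[folklore] -/
private def Good (π : List FV) : Prop :=
  ∀ j < π.length, ∀ i < j, triAt π i = triAt π j → triAt π (i + 1) = triAt π i

/-- `Good` is decidable. [folklore] -/
private instance (π : List FV) : Decidable (Good π) := by unfold Good; infer_instance

/-- The good A-walks of length `N` from `p` whose triangles avoid `S`. [folklore] -/
private def goodA (p : FV) (S : Finset HV) (N : ℕ) : Finset (List FV) :=
  (sawFin p N).filter fun π => IsA π ∧ Good π ∧ ∀ c ∈ π, c.1 ∉ S

/-- Membership in `goodA`. [folklore] -/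
private theorem mem_goodA {p : FV} {S : Finset HV} {N : ℕ} {π : List FV} :
    π ∈ goodA p S N ↔ π ∈ sawLists fisherGraph p N ∧ IsA π ∧ Good π ∧ ∀ c ∈ π, c.1 ∉ S := by
  rw [goodA, mem_filter, mem_sawFin_iff]

/-- `triAt` of a cons at a successor index. [folklore] -/
@[simp] private theorem triAt_cons_succ (a : FV) (l : List FV) (i : ℕ) : triAt (a :: l) (i + 1) = triAt l i := by
  simp [triAt, List.getD_eq_getElem?_getD]

/-- `triAt` at `0`. [folklore] -/
@[simp] private theorem triAt_cons_zero (a : FV) (l : List FV) : triAt (a :: l) 0 = a.1 := by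
  simp [triAt, List.getD_eq_getElem?_getD]

/-- Goodness passes to the tail. [folklore] -/
private theorem Good.tail {a : FV} {l : List FV} (h : Good (a :: l)) : Good l := by
  intro j hj i hij he
  have := h (j + 1) (by simp; omega) (i + 1) (by omega)
  simp only [triAt_cons_succ] at this
  exact this he

/-- A good walk that has left its first triangle never returns to it. [folklore] -/
private theorem Good.not_mem_of_left {a b : FV} {l : List FV} (h : Good (a :: b :: l)) (hab : b.1 ≠ a.1) :
    ∀ c ∈ b :: l, c.1 ≠ a.1 := by
  intro c hc heq
  obtain ⟨j, hj, hjc⟩ := List.getElem_of_mem hc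
  have := h (j + 1) (by simp only [List.length_cons] at hj ⊢; omega) 0 (by omega) (by
    rw [triAt_cons_zero, triAt_cons_succ, triAt, List.getD_eq_getElem?_getD, List.getElem?_eq_getElem hj,
      Option.getD_some, hjc, heq])
  rw [triAt_cons_succ, triAt_cons_zero, triAt_cons_zero] at this
  exact hab this

/-- A good A-walk starts at its root. [folklore] -/
private theorem exists_eq_cons_of_mem_goodA {p : FV} {S : Finset HV} {N : ℕ} {π : List FV} (h : π ∈ goodA p S N) :
    ∃ L, π = p :: L := by
  rw [mem_goodA] at h
  obtain ⟨⟨-, hh, -, -⟩, -⟩ := h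
  rcases π with _ | ⟨a, L⟩
  · simp at hh
  · exact ⟨L, by simpa using hh⟩

/-- At most one good A-walk of length `0`. [folklore] -/
private theorem card_goodA_zero (p : FV) (S : Finset HV) : (goodA p S 0).card ≤ 1 := by
  refine Finset.card_le_one.2 fun π hπ π' hπ' => ?_
  have h1 := (mem_goodA.1 hπ).1.2.2.1
  have h2 := (mem_goodA.1 hπ').1.2.2.1
  obtain ⟨L, rfl⟩ := exists_eq_cons_of_mem_goodA hπ
  obtain ⟨L', rfl⟩ := exists_eq_cons_of_mem_goodA hπ'
  simp at h1 h2
  rw [h1, h2]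

/-- The trivial walk is the good A-walk of length `0` when its triangle is allowed. [folklore] -/
private theorem card_goodA_zero_eq (p : FV) {S : Finset HV} (hp : p.1 ∉ S) : (goodA p S 0).card = 1 := by
  refine le_antisymm (card_goodA_zero p S) (Finset.card_pos.2 ⟨[p], ?_⟩)
  rw [mem_goodA]
  refine ⟨⟨List.isChain_singleton _, rfl, rfl, List.nodup_singleton _⟩, trivial, ?_, by simpa using hp⟩
  intro j hj i hij; simp at hj; omega

/-- At most two good A-walks of length `1` (towards the two other corners of the triangle). [folklore] -/
private theorem card_goodA_one (p : FV) (S : Finset HV) : (goodA p S 1).card ≤ 2 := by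
  classical
  have hsub : goodA p S 1 ⊆ ((univ : Finset (Fin 3)).erase p.2).image fun k' => [p, (p.1, k')] := by
    intro π hπ
    have h := mem_goodA.1 hπ
    obtain ⟨⟨hc, -, hl, hn⟩, hA, -, -⟩ := h
    obtain ⟨L, rfl⟩ := exists_eq_cons_of_mem_goodA hπ
    rcases L with _ | ⟨q, _ | ⟨r, L⟩⟩
    · simp at hl
    · simp only [IsA] at hA
      rw [mem_image]
      refine ⟨q.2, mem_erase.2 ⟨fun h => ?_, mem_univ _⟩, by rw [← hA]⟩
      have : q = p := Prod.ext hA h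
      simp [this] at hn
    · simp at hl
  refine (card_le_card hsub).trans (card_image_le.trans ?_)
  rw [card_erase_of_mem (mem_univ _), Finset.card_univ, Fintype.card_fin]

/-- The tail of a good A-walk after its first block (which ends at the corner `(v, k')` and crosses to
`(port v k', k')`) is a good A-walk avoiding `S ∪ {v}`. [folklore] -/
private theorem tail_mem_goodA {v : HV} {k' : Fin 3} {S : Finset HV} {pre rest : List FV} {M : ℕ}
    (hc : (pre ++ (v, k') :: (HV.port v k', k') :: rest).IsChain fisherGraph.Adj)
    (hn : (pre ++ (v, k') :: (HV.port v k', k') :: rest).Nodup)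
    (hG : Good ((v, k') :: (HV.port v k', k') :: rest))
    (hS : ∀ c ∈ (HV.port v k', k') :: rest, c.1 ∉ S) (hlen : rest.length = M) :
    (HV.port v k', k') :: rest ∈ goodA (HV.port v k', k') (insert v S) M := by
  rw [mem_goodA]
  have hc2 : ((v, k') :: (HV.port v k', k') :: rest).IsChain fisherGraph.Adj :=
    (List.isChain_append.1 hc).2.1
  have hrest : ((HV.port v k', k') :: rest).IsChain fisherGraph.Adj := (List.isChain_cons_cons.1 hc2).2
  have hn2 : ((v, k') :: (HV.port v k', k') :: rest).Nodup := hn.sublist (List.sublist_append_right _ _)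
  have hleft : (HV.port v k', k').1 ≠ (v, k').1 := HV.port_ne _ _
  refine ⟨⟨hrest, rfl, by simp [hlen], (List.nodup_cons.1 hn2).2⟩, ?_, hG.tail, fun c hcm => ?_⟩
  · rcases rest with _ | ⟨c₃, rest⟩
    · trivial
    · simp only [IsA]
      have hc23 : fisherGraph.Adj (HV.port v k', k') c₃ := (List.isChain_cons_cons.1 hrest).1
      rcases hc23 with ⟨h3a, -⟩ | ⟨h3a, h3b⟩
      · exact h3a.symm
      · exfalso
        simp only [HV.port_port] at h3a
        have : c₃ = (v, k') := Prod.ext h3a h3b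
        subst this
        simp at hn2
  · rw [Finset.mem_insert, not_or]
    exact ⟨hG.not_mem_of_left hleft c hcm, hS c hcm⟩

/-- **First-block recursion** (as an inequality): for `N ≥ 2`, a good A-walk from `(v, k)` avoiding `S`
either stays in the triangle (`N = 2`, two walks) or crosses to `(port v k', k')`, `k' ≠ k`, after a block
of `2` or `3` corners, and continues as a good A-walk avoiding `S ∪ {v}`. [folklore] -/
private theorem card_goodA_le (v : HV) (k : Fin 3) (S : Finset HV) (N : ℕ) (hN : 2 ≤ N) :
    (goodA (v, k) S N).card ≤ (if N = 2 then 2 else 0) +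
      ∑ k' ∈ (univ : Finset (Fin 3)).erase k,
        ((goodA (HV.port v k', k') (insert v S) (N - 2)).card +
          (goodA (HV.port v k', k') (insert v S) (N - 3)).card) := by
  classical
  set K := (univ : Finset (Fin 3)).erase k with hK
  set T₁ : Finset (List FV) := if N = 2 then K.image fun k' => [(v, k), (v, HV.third k k'), (v, k')] else ∅
  set T₂ : Finset (List FV) := K.biUnion fun k' =>
    (goodA (HV.port v k', k') (insert v S) (N - 2)).image fun τ => (v, k) :: (v, k') :: τ
  set T₃ : Finset (List FV) := K.biUnion fun k' =>
    (goodA (HV.port v k', k') (insert v S) (N - 3)).image fun τ => (v, k) :: (v, HV.third k k') :: (v, k') :: τ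
  have hsub : goodA (v, k) S N ⊆ T₁ ∪ (T₂ ∪ T₃) := by
    intro π hπ
    have hπ' := mem_goodA.1 hπ
    obtain ⟨⟨hc, -, hl, hn⟩, hA, hG, hS⟩ := hπ'
    obtain ⟨L, rfl⟩ := exists_eq_cons_of_mem_goodA hπ
    rcases L with _ | ⟨c₁, _ | ⟨c₂, rest⟩⟩
    · simp at hl; omega
    · simp at hl; omega
    obtain ⟨v₁, k₁⟩ := c₁
    simp only [IsA] at hA
    obtain rfl : v = v₁ := hA.symm
    have hk1 : k₁ ≠ k := by rintro rfl; simp at hn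
    have hc12 : fisherGraph.Adj (v, k₁) c₂ := (List.isChain_cons_cons.1 (List.isChain_cons_cons.1 hc).2).1
    rw [mem_union, mem_union]
    rcases hc12 with ⟨h2a, h2b⟩ | ⟨h2a, h2b⟩
    · -- block of size 3
      obtain ⟨v₂, k₂⟩ := c₂
      simp only at h2a h2b
      obtain rfl : v = v₂ := h2a
      have hk2k : k₂ ≠ k := by rintro rfl; simp at hn
      have hk2 : k₂ = HV.third k k₁ := by
        revert hk1 h2b hk2k; fin_cases k <;> fin_cases k₁ <;> fin_cases k₂ <;> decide
      have hk1' : k₁ = HV.third k k₂ := by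
        rw [hk2]; revert hk1; fin_cases k <;> fin_cases k₁ <;> decide
      rcases rest with _ | ⟨c₃, rest⟩
      · left
        have hN2 : N = 2 := by simp at hl; omega
        simp only [T₁, hN2, if_true, mem_image]
        exact ⟨k₂, mem_erase.2 ⟨hk2k, mem_univ _⟩, by rw [← hk1']⟩
      · right; right
        have hc23 : fisherGraph.Adj (v, k₂) c₃ :=
          (List.isChain_cons_cons.1 (List.isChain_cons_cons.1 (List.isChain_cons_cons.1 hc).2).2).1
        have hc3 : c₃ = (HV.port v k₂, k₂) := by
          rcases hc23 with ⟨h3a, h3b⟩ | ⟨h3a, h3b⟩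
          · exfalso
            obtain ⟨v₃, k₃⟩ := c₃
            simp only at h3a h3b
            obtain rfl : v = v₃ := h3a
            have : k₃ = k ∨ k₃ = k₁ := by
              revert hk1 h2b hk2k h3b; fin_cases k <;> fin_cases k₁ <;> fin_cases k₂ <;> fin_cases k₃ <;> decide
            rcases this with rfl | rfl <;> simp at hn
          · exact Prod.ext h3a h3b
        subst hc3
        simp only [T₃, mem_biUnion, mem_image]
        refine ⟨k₂, mem_erase.2 ⟨hk2k, mem_univ _⟩, (HV.port v k₂, k₂) :: rest, ?_, by rw [← hk1']⟩
        refine tail_mem_goodA (pre := [(v, k), (v, k₁)]) (by simpa using hc) (by simpa using hn)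
          hG.tail.tail (fun c hc' => hS c (by simp [hc'])) (by simp at hl ⊢; omega)
    · -- block of size 2
      obtain ⟨v₂, k₂⟩ := c₂
      simp only at h2a h2b
      subst h2a
      obtain rfl : k₁ = k₂ := h2b.symm
      right; left
      simp only [T₂, mem_biUnion, mem_image]
      refine ⟨k₁, mem_erase.2 ⟨hk1, mem_univ _⟩, (HV.port v k₁, k₁) :: rest, ?_, rfl⟩
      exact tail_mem_goodA (pre := [(v, k)]) (by simpa using hc) (by simpa using hn) hG.tail
        (fun c hc' => hS c (by simp [hc'])) (by simp at hl ⊢; omega)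
  have h1 : T₁.card ≤ if N = 2 then 2 else 0 := by
    simp only [T₁]
    split_ifs
    · refine card_image_le.trans ?_
      rw [hK, card_erase_of_mem (mem_univ _), Finset.card_univ, Fintype.card_fin]
    · simp
  have h2 : T₂.card ≤ ∑ k' ∈ K, (goodA (HV.port v k', k') (insert v S) (N - 2)).card :=
    card_biUnion_le.trans (sum_le_sum fun k' _ => card_image_le)
  have h3 : T₃.card ≤ ∑ k' ∈ K, (goodA (HV.port v k', k') (insert v S) (N - 3)).card :=
    card_biUnion_le.trans (sum_le_sum fun k' _ => card_image_le)
  calc (goodA (v, k) S N).card ≤ (T₁ ∪ (T₂ ∪ T₃)).card := card_le_card hsub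
    _ ≤ T₁.card + (T₂.card + T₃.card) := (card_union_le _ _).trans (add_le_add le_rfl (card_union_le _ _))
    _ ≤ _ := by rw [sum_add_distrib]; exact add_le_add h1 (add_le_add h2 h3)

end FV

/-! ### The upper bound, II: hexagonal walks avoiding a set, and the generating-function induction -/

namespace HV

/-- Hexagonal self-avoiding lists of length `n` from `v` avoiding the vertex set `S`. [folklore] -/
private def hgood (v : HV) (S : Finset HV) (n : ℕ) : Finset (List HV) := (sawFin v n).filter fun l => ∀ u ∈ l, u ∉ S

/-- Membership in `hgood`. [folklore] -/
private theorem mem_hgood {v : HV} {S : Finset HV} {n : ℕ} {l : List HV} :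
    l ∈ hgood v S n ↔ l ∈ sawLists hvGraph v n ∧ ∀ u ∈ l, u ∉ S := by
  rw [hgood, mem_filter, mem_sawFin_iff]

/-- `h₀ = 1` when the root is allowed. [folklore] -/
private theorem card_hgood_zero {v : HV} {S : Finset HV} (hv : v ∉ S) : (hgood v S 0).card = 1 := by
  refine le_antisymm (Finset.card_le_one.2 fun l hl l' hl' => ?_) (Finset.card_pos.2 ⟨[v], ?_⟩)
  · obtain ⟨⟨-, hh, hlen, -⟩, -⟩ := mem_hgood.1 hl
    obtain ⟨⟨-, hh', hlen', -⟩, -⟩ := mem_hgood.1 hl'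
    match l, l', hh, hh', hlen, hlen' with
    | [a], [b], hh, hh', _, _ => simp at hh hh'; rw [hh, hh']
  · rw [mem_hgood]
    exact ⟨⟨List.isChain_singleton _, rfl, rfl, List.nodup_singleton _⟩, by simpa using hv⟩

/-- Walks avoiding `S` cannot start in `S`. [folklore] -/
private theorem card_hgood_eq_zero {v : HV} {S : Finset HV} (hv : v ∈ S) (n : ℕ) : (hgood v S n).card = 0 := by
  rw [Finset.card_eq_zero, Finset.eq_empty_iff_forall_notMem]
  intro l hl
  obtain ⟨⟨-, hh, -, -⟩, hS⟩ := mem_hgood.1 hl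
  rcases l with _ | ⟨a, l⟩
  · simp at hh
  · simp only [List.head?_cons, Option.some.injEq] at hh
    exact hS a (by simp) (hh ▸ hv)

/-- **Prepending the root**: `Σ_{w = port v k ∉ S} h_n(w, S ∪ {v}) ≤ h_{n+1}(v, S)`. [folklore] -/
private theorem sum_card_hgood_le {v : HV} {S : Finset HV} (hv : v ∉ S) (n : ℕ) :
    ∑ k ∈ (univ : Finset (Fin 3)).filter (fun k => port v k ∉ S), (hgood (port v k) (insert v S) n).card ≤
      (hgood v S (n + 1)).card := by
  classical
  rw [← card_sigma]
  refine card_le_card_of_injOn (fun d => v :: d.2) ?_ ?_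
  · rintro ⟨k, l⟩ hd
    rw [mem_coe, mem_sigma, mem_filter] at hd
    obtain ⟨⟨-, hk⟩, hl⟩ := hd
    obtain ⟨⟨hc, hh, hlen, hn⟩, hS⟩ := mem_hgood.1 hl
    rw [mem_coe, mem_hgood]
    rcases l with _ | ⟨a, L⟩
    · simp at hh
    simp only [List.head?_cons, Option.some.injEq] at hh
    subst hh
    refine ⟨⟨List.IsChain.cons_cons (adj_port v k) hc, rfl, by simp at hlen ⊢; omega, ?_⟩, ?_⟩
    · rw [List.nodup_cons]
      exact ⟨fun h => (hS v h) (Finset.mem_insert_self v S), hn⟩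
    · intro u hu
      rcases List.mem_cons.1 hu with rfl | hu
      · exact hv
      · exact fun h => hS u hu (Finset.mem_insert_of_mem h)
  · rintro ⟨k, l⟩ hd ⟨k', l'⟩ hd' h
    rw [mem_coe, mem_sigma, mem_filter] at hd hd'
    have hl : l = l' := (List.cons_eq_cons.1 h).2
    subst hl
    obtain ⟨⟨-, hh, -, -⟩, -⟩ := mem_hgood.1 hd.2
    obtain ⟨⟨-, hh', -, -⟩, -⟩ := mem_hgood.1 hd'.2
    rw [hh'] at hh
    simp only [Option.some.injEq] at hh
    rw [port_injective v hh]

/-- `hgood v ∅ n` is all of `sawFin v n`. [folklore] -/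
private theorem hgood_empty (v : HV) (n : ℕ) : hgood v ∅ n = sawFin v n := by
  rw [hgood, Finset.filter_true_of_mem]; simp

end HV

namespace FV

/-- Good A-walks avoiding `S` cannot start in `S`. [folklore] -/
private theorem card_goodA_eq_zero {v : HV} {k : Fin 3} {S : Finset HV} (hv : v ∈ S) (N : ℕ) :
    (goodA (v, k) S N).card = 0 := by
  rw [Finset.card_eq_zero, Finset.eq_empty_iff_forall_notMem]
  intro π hπ
  have hS := (mem_goodA.1 hπ).2.2.2
  obtain ⟨L, rfl⟩ := exists_eq_cons_of_mem_goodA hπ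
  exact hS (v, k) (by simp) hv

/-- **Generating-function domination**: for `0 ≤ x ≤ 1`, every `M`, every allowed root `(v, k)`:
`Σ_{N ≤ M} #goodA((v,k), S, N) x^N ≤ (1 + 2x + 4x²) · Σ_{n ≤ M} #hgood(v, S, n) (x²(1+x))ⁿ`.
[folklore] -/
private theorem gf_goodA_le {x : ℝ} (hx0 : 0 ≤ x) :
    ∀ (M : ℕ) (v : HV) (k : Fin 3) (S : Finset HV), v ∉ S →
      ∑ N ∈ range (M + 1), ((goodA (v, k) S N).card : ℝ) * x ^ N ≤
        (1 + 2 * x + 4 * x ^ 2) * ∑ n ∈ range (M + 1), ((HV.hgood v S n).card : ℝ) * (x ^ 2 * (1 + x)) ^ n := by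
  classical
  set c := 1 + 2 * x + 4 * x ^ 2 with hc
  set y := x ^ 2 * (1 + x) with hy
  have hc1 : 1 ≤ c := by rw [hc]; nlinarith
  have hy0 : 0 ≤ y := by rw [hy]; positivity
  intro M
  induction M using Nat.strong_induction_on with
  | _ M ih =>
    intro v k S hv
    -- the hexagonal side is at least `c` (term `n = 0`)
    have hH0 : ∀ M', 1 ≤ ∑ n ∈ range (M' + 1), ((HV.hgood v S n).card : ℝ) * y ^ n := fun M' => by
      have h0 : ((HV.hgood v S 0).card : ℝ) * y ^ 0 = 1 := by rw [HV.card_hgood_zero hv]; simp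
      rw [← h0]
      exact single_le_sum (f := fun n => ((HV.hgood v S n).card : ℝ) * y ^ n) (fun n _ => by positivity)
        (mem_range.2 (Nat.succ_pos _))
    have hg0 : ((goodA (v, k) S 0).card : ℝ) ≤ 1 := by exact_mod_cast card_goodA_zero _ _
    have hg1 : ((goodA (v, k) S 1).card : ℝ) ≤ 2 := by exact_mod_cast card_goodA_one _ _
    rcases Nat.lt_or_ge M 2 with hM | hM
    · -- M = 0 or 1
      have : ∑ N ∈ range (M + 1), ((goodA (v, k) S N).card : ℝ) * x ^ N ≤ 1 + 2 * x := by
        interval_cases M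
        · simp; linarith
        · rw [sum_range_succ, sum_range_succ, sum_range_zero]; simp; nlinarith
      calc _ ≤ 1 + 2 * x := this
        _ ≤ c * 1 := by rw [hc]; nlinarith
        _ ≤ c * _ := mul_le_mul_of_nonneg_left (hH0 M) (by linarith)
    -- M ≥ 2: split off `N = 0, 1` and apply the first-block recursion to `N ≥ 2`
    obtain ⟨M', rfl⟩ : ∃ M', M = M' + 2 := ⟨M - 2, by omega⟩
    set K := (univ : Finset (Fin 3)).erase k with hK
    set G' : Fin 3 → ℕ → ℝ := fun k' L => ∑ m ∈ range (L + 1),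
      ((goodA (HV.port v k', k') (insert v S) m).card : ℝ) * x ^ m with hG'
    have hG'nn : ∀ k' L, 0 ≤ G' k' L := fun k' L => sum_nonneg fun m _ => by positivity
    -- the recursion, term by term, for `N = m + 2`
    have hrec : ∀ m, ((goodA (v, k) S (m + 2)).card : ℝ) * x ^ (m + 2) ≤
        (if m = 0 then 2 * x ^ 2 else 0) + ∑ k' ∈ K, (x ^ 2 * (((goodA (HV.port v k', k') (insert v S) m).card : ℝ) * x ^ m) +
          x ^ (m + 2) * ((goodA (HV.port v k', k') (insert v S) (m + 2 - 3)).card : ℝ)) := by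
      intro m
      have h := card_goodA_le v k S (m + 2) (by omega)
      have h' : ((goodA (v, k) S (m + 2)).card : ℝ) ≤ (if m + 2 = 2 then 2 else 0 : ℝ) +
          ∑ k' ∈ K, (((goodA (HV.port v k', k') (insert v S) (m + 2 - 2)).card : ℝ) +
            ((goodA (HV.port v k', k') (insert v S) (m + 2 - 3)).card : ℝ)) := by exact_mod_cast h
      rw [show m + 2 - 2 = m by omega] at h'
      have hx2 : 0 ≤ x ^ (m + 2) := pow_nonneg hx0 _
      calc ((goodA (v, k) S (m + 2)).card : ℝ) * x ^ (m + 2)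
          ≤ ((if m + 2 = 2 then 2 else 0 : ℝ) + ∑ k' ∈ K, (((goodA (HV.port v k', k') (insert v S) m).card : ℝ) +
              ((goodA (HV.port v k', k') (insert v S) (m + 2 - 3)).card : ℝ))) * x ^ (m + 2) :=
            mul_le_mul_of_nonneg_right h' hx2
        _ = _ := by
            rw [add_mul, sum_mul]
            congr 1
            · split_ifs with h1 h2 h2
              · simp at h1; subst h1; ring
              · simp at h1; exact absurd h1 h2
              · subst h2; simp at h1
              · simp
            · refine sum_congr rfl fun k' _ => ?_; ring
    -- sum the recursion over `m ≤ M'`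
    have hsum2 : ∑ m ∈ range (M' + 1), ((goodA (v, k) S (m + 2)).card : ℝ) * x ^ (m + 2) ≤
        2 * x ^ 2 + ∑ k' ∈ K, (x ^ 2 * G' k' M' + (x ^ 2 + x ^ 3 * G' k' M')) := by
      refine (sum_le_sum fun m _ => hrec m).trans ?_
      rw [sum_add_distrib, sum_comm]
      refine add_le_add ?_ (sum_le_sum fun k' _ => ?_)
      · rw [sum_ite_eq' (range (M' + 1)) 0 (fun _ => 2 * x ^ 2)]; simp
      rw [sum_add_distrib]
      refine add_le_add (by rw [← mul_sum]) ?_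
      -- the `N - 3` terms: `m = 0` is spurious (≤ x²), the rest shift by three
      rw [sum_range_succ', show (0 + 2 - 3 : ℕ) = 0 by norm_num]
      have hsp : x ^ (0 + 2) * ((goodA (HV.port v k', k') (insert v S) 0).card : ℝ) ≤ x ^ 2 := by
        have : ((goodA (HV.port v k', k') (insert v S) 0).card : ℝ) ≤ 1 := by exact_mod_cast card_goodA_zero _ _
        rw [show 0 + 2 = 2 by rfl]
        exact mul_le_of_le_one_right (pow_nonneg hx0 2) this
      have hshift : ∑ m ∈ range M', x ^ (m + 1 + 2) * ((goodA (HV.port v k', k') (insert v S) (m + 1 + 2 - 3)).card : ℝ)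
          ≤ x ^ 3 * G' k' M' := by
        rw [hG', mul_sum]
        calc ∑ m ∈ range M', x ^ (m + 1 + 2) * ((goodA (HV.port v k', k') (insert v S) (m + 1 + 2 - 3)).card : ℝ)
            = ∑ m ∈ range M', x ^ 3 * (((goodA (HV.port v k', k') (insert v S) m).card : ℝ) * x ^ m) :=
              sum_congr rfl fun m _ => by rw [show m + 1 + 2 - 3 = m by omega]; ring
          _ ≤ ∑ m ∈ range (M' + 1), x ^ 3 * (((goodA (HV.port v k', k') (insert v S) m).card : ℝ) * x ^ m) :=
              sum_le_sum_of_subset_of_nonneg (range_subset_range.2 (Nat.le_succ M')) fun m _ _ => by positivity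
      linarith
    -- the induction hypothesis on each branch (or zero if the branch root is forbidden)
    have hIH : ∀ k' ∈ K, G' k' M' ≤ c * ∑ n ∈ range (M' + 1),
        ((HV.hgood (HV.port v k') (insert v S) n).card : ℝ) * y ^ n := by
      intro k' _
      by_cases hw : HV.port v k' ∈ S
      · have : G' k' M' = 0 := sum_eq_zero fun m _ => by
          rw [card_goodA_eq_zero (Finset.mem_insert_of_mem hw)]; simp
        rw [this]
        exact mul_nonneg (by linarith) (sum_nonneg fun n _ => by positivity)
      · exact ih M' (by omega) (HV.port v k') k' (insert v S)
          (by rw [Finset.mem_insert, not_or]; exact ⟨HV.port_ne v k', hw⟩)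
    -- the hexagonal prepend bound
    have hhex : y * ∑ k' ∈ K, ∑ n ∈ range (M' + 1), ((HV.hgood (HV.port v k') (insert v S) n).card : ℝ) * y ^ n ≤
        ∑ n ∈ range (M' + 2 + 1), ((HV.hgood v S n).card : ℝ) * y ^ n - 1 := by
      have hKle : ∑ k' ∈ K, ∑ n ∈ range (M' + 1), ((HV.hgood (HV.port v k') (insert v S) n).card : ℝ) * y ^ n ≤
          ∑ n ∈ range (M' + 1), ((HV.hgood v S (n + 1)).card : ℝ) * y ^ n := by
        rw [sum_comm]
        refine sum_le_sum fun n _ => ?_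
        rw [← sum_mul]
        refine mul_le_mul_of_nonneg_right ?_ (pow_nonneg hy0 n)
        have h1 : ∑ k' ∈ K, ((HV.hgood (HV.port v k') (insert v S) n).card : ℝ) ≤
            ∑ k' ∈ (univ : Finset (Fin 3)).filter (fun k' => HV.port v k' ∉ S),
              ((HV.hgood (HV.port v k') (insert v S) n).card : ℝ) := by
          rw [← sum_filter_add_sum_filter_not K (fun k' => HV.port v k' ∉ S)]
          have hz : ∑ k' ∈ K.filter (fun k' => ¬ HV.port v k' ∉ S),
              ((HV.hgood (HV.port v k') (insert v S) n).card : ℝ) = 0 :=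
            sum_eq_zero fun k' hk' => by
              rw [mem_filter, not_not] at hk'
              rw [HV.card_hgood_eq_zero (Finset.mem_insert_of_mem hk'.2)]; simp
          rw [hz, add_zero]
          exact sum_le_sum_of_subset_of_nonneg (fun k' hk' => by
            rw [mem_filter] at hk' ⊢; exact ⟨mem_univ _, hk'.2⟩) fun _ _ _ => by positivity
        refine h1.trans ?_
        rw [← Nat.cast_sum]
        exact Nat.cast_le.2 (HV.sum_card_hgood_le hv n)
      have h0 : ((HV.hgood v S 0).card : ℝ) * y ^ 0 = 1 := by rw [HV.card_hgood_zero hv]; simp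
      calc y * ∑ k' ∈ K, ∑ n ∈ range (M' + 1), ((HV.hgood (HV.port v k') (insert v S) n).card : ℝ) * y ^ n
          ≤ y * ∑ n ∈ range (M' + 1), ((HV.hgood v S (n + 1)).card : ℝ) * y ^ n :=
            mul_le_mul_of_nonneg_left hKle hy0
        _ = ∑ n ∈ range (M' + 1), ((HV.hgood v S (n + 1)).card : ℝ) * y ^ (n + 1) := by
            rw [mul_sum]; exact sum_congr rfl fun n _ => by ring
        _ ≤ ∑ n ∈ range (M' + 2), ((HV.hgood v S (n + 1)).card : ℝ) * y ^ (n + 1) :=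
            sum_le_sum_of_subset_of_nonneg (range_subset_range.2 (by norm_num))
              fun n _ _ => mul_nonneg (Nat.cast_nonneg _) (pow_nonneg hy0 _)
        _ = ∑ n ∈ range (M' + 2 + 1), ((HV.hgood v S n).card : ℝ) * y ^ n - 1 := by
            rw [sum_range_succ' (fun n => ((HV.hgood v S n).card : ℝ) * y ^ n) (M' + 2), h0]; ring
    -- assemble
    have hmain := calc
      ∑ m ∈ range (M' + 1), ((goodA (v, k) S (m + 1 + 1)).card : ℝ) * x ^ (m + 1 + 1)
          = ∑ m ∈ range (M' + 1), ((goodA (v, k) S (m + 2)).card : ℝ) * x ^ (m + 2) := rfl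
      _ ≤ 2 * x ^ 2 + ∑ k' ∈ K, (x ^ 2 * G' k' M' + (x ^ 2 + x ^ 3 * G' k' M')) := hsum2
      _ = 2 * x ^ 2 + ((∑ _k' ∈ K, x ^ 2) + y * ∑ k' ∈ K, G' k' M') := by
          rw [hy, mul_sum, ← sum_add_distrib]; exact congrArg _ (sum_congr rfl fun k' _ => by ring)
      _ ≤ 2 * x ^ 2 + (2 * x ^ 2 + y * ∑ k' ∈ K, c * ∑ n ∈ range (M' + 1),
            ((HV.hgood (HV.port v k') (insert v S) n).card : ℝ) * y ^ n) := by
          have hKc : (∑ _k' ∈ K, x ^ 2) = 2 * x ^ 2 := by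
            rw [sum_const, hK, card_erase_of_mem (mem_univ _), Finset.card_univ, Fintype.card_fin]; simp
          rw [hKc]
          exact add_le_add le_rfl (add_le_add le_rfl (mul_le_mul_of_nonneg_left (sum_le_sum hIH) hy0))
      _ = 4 * x ^ 2 + c * (y * ∑ k' ∈ K, ∑ n ∈ range (M' + 1),
            ((HV.hgood (HV.port v k') (insert v S) n).card : ℝ) * y ^ n) := by rw [← mul_sum]; ring
      _ ≤ 4 * x ^ 2 + c * (∑ n ∈ range (M' + 2 + 1), ((HV.hgood v S n).card : ℝ) * y ^ n - 1) :=
          add_le_add le_rfl (mul_le_mul_of_nonneg_left hhex (by linarith))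
    conv_lhs => rw [show M' + 2 + 1 = M' + 1 + 1 + 1 from rfl, sum_range_succ', sum_range_succ']
    simp only [pow_zero, mul_one, zero_add, pow_one]
    have h1x : ((goodA (v, k) S 1).card : ℝ) * x ≤ 2 * x := mul_le_mul_of_nonneg_right hg1 hx0
    have hx2 : 0 ≤ x ^ 2 := pow_nonneg hx0 2
    linarith [hmain, hg0, h1x, hc]

end FV

/-! ### The upper bound, III: from all walks to good A-walks -/

namespace FV

/-- The neighbour across the connecting edge. [folklore] -/
private def ext (p : FV) : FV := (HV.port p.1 p.2, p.2)

/-- `ext` is an involution. [folklore] -/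
@[simp] private theorem ext_ext (p : FV) : ext (ext p) = p := by
  obtain ⟨w, k⟩ := p; simp [ext, HV.port_port]

/-- `ext p` is adjacent to `p`. [folklore] -/
private theorem adj_ext (p : FV) : fisherGraph.Adj p (ext p) := by
  rw [fisherGraph_adj]; exact Or.inr ⟨rfl, rfl⟩

/-- `ext p` lies in another triangle. [folklore] -/
private theorem fst_ext_ne (p : FV) : (ext p).1 ≠ p.1 := HV.port_ne _ _

/-- A neighbour in another triangle is the external neighbour. [folklore] -/
private theorem eq_ext_of_adj {p q : FV} (h : fisherGraph.Adj p q) (hne : q.1 ≠ p.1) : q = ext p := by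
  rw [fisherGraph_adj, AdjRel] at h
  rcases h with ⟨h1, -⟩ | ⟨h1, h2⟩
  · exact absurd h1.symm hne
  · exact Prod.ext h1 h2

/-- The three neighbours of a corner, indexed by `Fin 3`. [folklore] -/
private def nbr (p : FV) (t : Fin 3) : FV := if t = p.2 then ext p else (p.1, t)

/-- Every neighbour is some `nbr p t`. [folklore] -/
private theorem exists_nbr_eq_of_adj {p q : FV} (h : fisherGraph.Adj p q) : ∃ t, nbr p t = q := by
  by_cases hq : q.1 = p.1
  · refine ⟨q.2, ?_⟩
    rw [fisherGraph_adj, AdjRel] at h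
    rcases h with ⟨-, h2⟩ | ⟨h1, -⟩
    · rw [nbr, if_neg (Ne.symm h2)]; exact Prod.ext hq.symm rfl
    · exact absurd (hq.symm.trans h1).symm (HV.port_ne p.1 p.2)
  · exact ⟨p.2, by rw [nbr, if_pos rfl, eq_ext_of_adj h hq]⟩

/-- Pigeonhole in a triangle: three distinct corners exhaust it. [folklore] -/
private theorem corner_cases {a b c q : FV} (hb : b.1 = a.1) (hc : c.1 = a.1) (hq : q.1 = a.1)
    (hab : a ≠ b) (hbc : b ≠ c) (hac : a ≠ c) : q = a ∨ q = b ∨ q = c := by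
  have key : ∀ x y z w : Fin 3, x ≠ y → y ≠ z → x ≠ z → w = x ∨ w = y ∨ w = z := by decide
  have h2 : a.2 ≠ b.2 := fun h => hab (Prod.ext hb.symm h)
  have h3 : b.2 ≠ c.2 := fun h => hbc (Prod.ext (hb.trans hc.symm) h)
  have h4 : a.2 ≠ c.2 := fun h => hac (Prod.ext hc.symm h)
  rcases key a.2 b.2 c.2 q.2 h2 h3 h4 with h | h | h
  · exact Or.inl (Prod.ext hq h)
  · exact Or.inr (Or.inl (Prod.ext (hq.trans hb.symm) h))
  · exact Or.inr (Or.inr (Prod.ext (hq.trans hc.symm) h))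

/-- `triAt` as a `getElem`. [folklore] -/
private theorem triAt_eq_getElem {π : List FV} {i : ℕ} (hi : i < π.length) : triAt π i = (π[i]).1 := by
  rw [triAt, List.getD_eq_getElem?_getD, List.getElem?_eq_getElem hi, Option.getD_some]

/-- `triAt` of a prefix. [folklore] -/
private theorem triAt_take {π : List FV} {m i : ℕ} (hi : i < m) : triAt (π.take m) i = triAt π i := by
  simp only [triAt, List.getD_eq_getElem?_getD, List.getElem?_take, if_pos hi]

/-- The A-property in index form. [folklore] -/
private theorem IsA.fst_eq {π : List FV} (hA : IsA π) (h1 : 1 < π.length) : (π[1]).1 = (π[0]).1 := by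
  rcases π with _ | ⟨p, _ | ⟨q, r⟩⟩
  · simp at h1
  · simp at h1
  · exact hA

/-- The A-property passes to prefixes. [folklore] -/
private theorem IsA.take {π : List FV} (hA : IsA π) (m : ℕ) : IsA (π.take m) := by
  rcases π with _ | ⟨p, _ | ⟨q, r⟩⟩
  · simp; exact hA
  · rcases m with _ | m
    · simp [IsA]
    · simp; exact hA
  · rcases m with _ | _ | m
    · simp [IsA]
    · simp [IsA]
    · simp only [List.take_succ_cons]; exact hA

/-- Prefixes of self-avoiding lists. [folklore] -/
private theorem take_mem_sawLists {p : FV} {M m : ℕ} {π : List FV} (hπ : π ∈ sawLists fisherGraph p M)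
    (hm : m ≤ M) : π.take (m + 1) ∈ sawLists fisherGraph p m := by
  obtain ⟨hc, hh, hlen, hnd⟩ := hπ
  refine ⟨hc.take _, ?_, ?_, List.Nodup.sublist (List.take_sublist _ _) hnd⟩
  · rw [List.head?_take, if_neg (Nat.succ_ne_zero m), hh]
  · rw [List.length_take, hlen]; omega

/-- **No extension past a re-entry**: an A-walk whose last corner re-enters a triangle it left
earlier (with no earlier re-entry) has all the neighbours of its endpoint on the walk. [folklore] -/
private theorem stuck {p : FV} {n : ℕ} {ρ : List FV} (hρ : ρ ∈ sawLists fisherGraph p n) (hA : IsA ρ)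
    {i : ℕ} (hin : i < n) (hT : triAt ρ i = triAt ρ n) (hleft : triAt ρ (i + 1) ≠ triAt ρ i)
    (hmin : ∀ j < n, ∀ i' < j, triAt ρ i' = triAt ρ j → triAt ρ (i' + 1) = triAt ρ i')
    {q : FV} (hq : fisherGraph.Adj (ρ.getD n fRoot) q) : q ∈ ρ := by
  obtain ⟨hc, -, hlen, hnd⟩ := hρ
  have hl : ∀ m, m ≤ n → m < ρ.length := fun m hm => by rw [hlen]; omega
  have htri : ∀ m (hm : m ≤ n), triAt ρ m = (ρ[m]'(hl m hm)).1 := fun m hm => triAt_eq_getElem _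
  have hadj : ∀ m m' (hmm : m' = m + 1) (hm' : m' ≤ n),
      fisherGraph.Adj (ρ[m]'(hl m (by omega))) (ρ[m']'(hl m' hm')) := by
    intro m m' hmm hm'; subst hmm; exact hc.getElem m (by rw [hlen]; omega)
  have hinj : ∀ m m' (hm : m ≤ n) (hm' : m' ≤ n), ρ[m]'(hl m hm) = ρ[m']'(hl m' hm') → m = m' :=
    fun m m' hm hm' h => hnd.getElem_inj_iff.1 h
  -- the corner after `i` is the external neighbour of `c i`
  have hF1 : ρ[i + 1]'(hl (i + 1) hin) = ext (ρ[i]'(hl i hin.le)) := by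
    refine eq_ext_of_adj (hadj i (i + 1) rfl hin) ?_
    rw [← htri (i + 1) hin, ← htri i hin.le]; exact hleft
  -- `i ≥ 1` by the A-property
  have hi1 : 1 ≤ i := by
    rcases Nat.eq_zero_or_pos i with rfl | h
    · exfalso; apply hleft
      rw [htri 1 (by omega), htri 0 (by omega)]
      exact hA.fst_eq (by rw [hlen]; omega)
    · exact h
  -- the corner before `i` lies in the same triangle
  have hF2 : (ρ[i - 1]'(hl (i - 1) (by omega))).1 = (ρ[i]'(hl i hin.le)).1 := by
    by_contra hne
    have h1 : ρ[i]'(hl i hin.le) = ext (ρ[i - 1]'(hl (i - 1) (by omega))) :=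
      eq_ext_of_adj (hadj (i - 1) i (by omega) hin.le) (Ne.symm hne)
    have h2 : ρ[i - 1]'(hl (i - 1) (by omega)) = ρ[i + 1]'(hl (i + 1) hin) := by
      rw [hF1, h1, ext_ext]
    have := hinj _ _ (by omega) hin h2
    omega
  -- `n ≥ i + 2`, the corner before `n` is outside the triangle, hence is `ext (c n)`
  have hn2 : i + 2 ≤ n := by
    by_contra h
    have hn : n = i + 1 := by omega
    subst hn
    exact hleft hT.symm
  have hF3 : (ρ[n - 1]'(hl (n - 1) (by omega))).1 ≠ (ρ[n]'(hl n le_rfl)).1 := by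
    intro heq
    apply hleft
    refine hmin (n - 1) (by omega) i (by omega) ?_
    rw [htri i hin.le, htri (n - 1) (by omega), heq, ← htri n le_rfl, ← hT, htri i hin.le]
  have hF3' : ρ[n - 1]'(hl (n - 1) (by omega)) = ext (ρ[n]'(hl n le_rfl)) := by
    have h1 : ρ[n]'(hl n le_rfl) = ext (ρ[n - 1]'(hl (n - 1) (by omega))) :=
      eq_ext_of_adj (hadj (n - 1) n (by omega) le_rfl) hF3.symm
    rw [h1, ext_ext]
  -- the three corners `c (i-1), c i, c n` exhaust the triangle
  have hTi : (ρ[i]'(hl i hin.le)).1 = (ρ[n]'(hl n le_rfl)).1 := by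
    rw [← htri i hin.le, ← htri n le_rfl]; exact hT
  have hqn : ρ.getD n fRoot = ρ[n]'(hl n le_rfl) := by
    rw [List.getD_eq_getElem?_getD, List.getElem?_eq_getElem (hl n le_rfl), Option.getD_some]
  rw [hqn] at hq
  obtain ⟨t, rfl⟩ := exists_nbr_eq_of_adj hq
  by_cases ht : t = (ρ[n]'(hl n le_rfl)).2
  · rw [nbr, if_pos ht, ← hF3']; exact List.getElem_mem _
  · rw [nbr, if_neg ht]
    rcases corner_cases (a := ρ[n]'(hl n le_rfl)) (b := ρ[i]'(hl i hin.le)) (c := ρ[i - 1]'(hl (i - 1) (by omega)))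
      (q := ((ρ[n]'(hl n le_rfl)).1, t)) hTi (hF2.trans hTi) rfl
      (fun h => by have := hinj _ _ le_rfl hin.le h; omega)
      (fun h => by have := hinj _ _ hin.le (by omega) h; omega)
      (fun h => by have := hinj _ _ le_rfl (by omega) h; omega) with h | h | h <;>
    · rw [h]; exact List.getElem_mem _

/-- A bad pair ending at index `j`. A decidable predicate, not a named fact. [folklore] -/
private def BadAt (π : List FV) (j : ℕ) : Prop :=
  j < π.length ∧ ∃ i < j, triAt π i = triAt π j ∧ triAt π (i + 1) ≠ triAt π i

/-- `BadAt` is decidable. [folklore] -/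
private instance (π : List FV) (j : ℕ) : Decidable (BadAt π j) := by unfold BadAt; infer_instance

/-- A walk that is not good has a bad pair. [folklore] -/
private theorem exists_badAt_of_not_good {π : List FV} (h : ¬ Good π) : ∃ j, BadAt π j := by
  by_contra hne
  apply h
  intro j hj i hij he
  by_contra hc
  exact hne ⟨j, hj, i, hij, he, hc⟩

/-- **Defects are terminal**: a non-good A-walk of length `M` has `M ≥ 1` and a good prefix of
length `M - 1`. [folklore] -/
private theorem good_take_of_not_good {p : FV} {M : ℕ} {π : List FV} (hπ : π ∈ sawLists fisherGraph p M)
    (hA : IsA π) (hG : ¬ Good π) : 1 ≤ M ∧ Good (π.take M) := by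
  classical
  have hex := exists_badAt_of_not_good hG
  obtain ⟨hj₀len, i, hij, hT, hleft⟩ := Nat.find_spec hex
  have hmin : ∀ j < Nat.find hex, ¬ BadAt π j := fun j hj => Nat.find_min hex hj
  set j₀ := Nat.find hex with hj₀
  have hlen := hπ.2.2.1
  have hnd := hπ.2.2.2
  -- the minimal bad index is the last one
  have hjM : j₀ = M := by
    by_contra hne
    have hj₀M : j₀ < M := by omega
    have hρ : π.take (j₀ + 1) ∈ sawLists fisherGraph p j₀ := take_mem_sawLists hπ hj₀M.le
    have hq : fisherGraph.Adj ((π.take (j₀ + 1)).getD j₀ fRoot) (π[j₀ + 1]'(by rw [hlen]; omega)) := by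
      rw [List.getD_eq_getElem?_getD, List.getElem?_take, if_pos (Nat.lt_succ_self _),
        List.getElem?_eq_getElem (by rw [hlen]; omega), Option.getD_some]
      exact hπ.1.getElem j₀ (by rw [hlen]; omega)
    have hmem := stuck hρ (hA.take _) hij
      (by rw [triAt_take (by omega), triAt_take (by omega)]; exact hT)
      (by rw [triAt_take (by omega), triAt_take (by omega)]; exact hleft)
      (fun j hj i' hi' h => by
        rw [triAt_take (by omega), triAt_take (by omega)] at h
        rw [triAt_take (by omega), triAt_take (by omega)]
        by_contra hc
        exact hmin j hj ⟨by rw [hlen]; omega, i', hi', h, hc⟩) hq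
    obtain ⟨m, hm, hmeq⟩ := List.mem_iff_getElem.1 hmem
    rw [List.getElem_take] at hmeq
    have h1 := hnd.getElem_inj_iff.1 hmeq
    rw [List.length_take] at hm
    omega
  refine ⟨by omega, fun j hj i' hi' h => ?_⟩
  rw [List.length_take, hlen] at hj
  have hjM' : j < M := by omega
  rw [triAt_take (by omega), triAt_take (by omega)] at h
  rw [triAt_take (by omega), triAt_take (by omega)]
  by_contra hc
  exact hmin j (by omega) ⟨by rw [hlen]; omega, i', hi', h, hc⟩

/-- The A-walks of length `M` from `p`. [folklore] -/
private def Aw (p : FV) (M : ℕ) : Finset (List FV) := (sawFin p M).filter fun π => IsA π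

/-- The last corner of a list (junk on `[]`). [folklore] -/
private def lastC (ρ : List FV) : FV := ρ.getLast?.getD fRoot

/-- The last corner of a proper prefix. [folklore] -/
private theorem lastC_take {π : List FV} {M : ℕ} (h : M < π.length) (hM : 1 ≤ M) :
    lastC (π.take M) = π[M - 1] := by
  rw [lastC, List.getLast?_eq_getElem?, List.length_take, min_eq_left h.le, List.getElem?_take,
    if_pos (by omega), List.getElem?_eq_getElem (by omega), Option.getD_some]

/-- **A-walks vs good A-walks**: `a_M ≤ g_M + 3·g_{M-1}` (defects are terminal). [folklore] -/
private theorem card_Aw_le (p : FV) (M : ℕ) :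
    (Aw p M).card ≤ (goodA p ∅ M).card + 3 * (goodA p ∅ (M - 1)).card := by
  classical
  have hsub : Aw p M ⊆ goodA p ∅ M ∪ ((goodA p ∅ (M - 1)) ×ˢ (univ : Finset (Fin 3))).image
      (fun ρt => ρt.1 ++ [nbr (lastC ρt.1) ρt.2]) := by
    intro π hπ
    rw [Aw, mem_filter, mem_sawFin_iff] at hπ
    obtain ⟨hπ, hA⟩ := hπ
    rw [mem_union]
    by_cases hG : Good π
    · exact Or.inl (mem_goodA.2 ⟨hπ, hA, hG, fun c _ h => Finset.notMem_empty _ h⟩)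
    right
    obtain ⟨hM, hgood⟩ := good_take_of_not_good hπ hA hG
    have hlen := hπ.2.2.1
    obtain ⟨M', rfl⟩ : ∃ M', M = M' + 1 := ⟨M - 1, by omega⟩
    rw [show M' + 1 - 1 = M' from rfl]
    have hadj : fisherGraph.Adj (π[M']'(by rw [hlen]; omega)) (π[M' + 1]'(by rw [hlen]; omega)) :=
      hπ.1.getElem M' (by rw [hlen]; omega)
    obtain ⟨t, ht⟩ := exists_nbr_eq_of_adj hadj
    rw [mem_image]
    refine ⟨(π.take (M' + 1), t), mem_product.2 ⟨mem_goodA.2 ⟨take_mem_sawLists hπ (Nat.le_succ _),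
      hA.take _, hgood, fun c _ h => Finset.notMem_empty _ h⟩, mem_univ _⟩, ?_⟩
    have hlast : lastC (π.take (M' + 1)) = π[M']'(by rw [hlen]; omega) := by
      have := lastC_take (π := π) (M := M' + 1) (by rw [hlen]; omega) (by omega)
      simpa using this
    simp only
    rw [hlast, ht, ← List.take_succ_eq_append_getElem, List.take_of_length_le (by rw [hlen])]
  calc (Aw p M).card ≤ _ := card_le_card hsub
    _ ≤ (goodA p ∅ M).card + (((goodA p ∅ (M - 1)) ×ˢ (univ : Finset (Fin 3))).image
          (fun ρt => ρt.1 ++ [nbr (lastC ρt.1) ρt.2])).card := card_union_le _ _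
    _ ≤ (goodA p ∅ M).card + ((goodA p ∅ (M - 1)) ×ˢ (univ : Finset (Fin 3))).card :=
        add_le_add le_rfl card_image_le
    _ = _ := by rw [card_product, Finset.card_univ, Fintype.card_fin]; ring

/-- **All walks vs A-walks**: `c_N ≤ a_N(p) + a_{N-1}(ext p)` (a B-walk minus its first corner is
an A-walk from the external neighbour). [folklore] -/
private theorem card_sawFin_le_Aw (p : FV) (N : ℕ) :
    (sawFin p N).card ≤ (Aw p N).card + (Aw (ext p) (N - 1)).card := by
  classical
  have hsub : sawFin p N ⊆ Aw p N ∪ (Aw (ext p) (N - 1)).image (List.cons p) := by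
    intro π hπ
    rw [mem_union]
    have hπ' := mem_sawFin_iff.1 hπ
    by_cases hA : IsA π
    · exact Or.inl (by rw [Aw, mem_filter]; exact ⟨hπ, hA⟩)
    right
    obtain ⟨hc, hh, hlen, hnd⟩ := hπ'
    rcases π with _ | ⟨a, _ | ⟨b, rest⟩⟩
    · simp at hh
    · exact absurd trivial hA
    simp only [List.head?_cons, Option.some.injEq] at hh
    subst hh
    have hab : fisherGraph.Adj a b := (List.isChain_cons_cons.1 hc).1
    have hb : b = ext a := eq_ext_of_adj hab hA
    rw [mem_image]
    refine ⟨b :: rest, ?_, rfl⟩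
    rw [Aw, mem_filter, mem_sawFin_iff]
    refine ⟨⟨(List.isChain_cons_cons.1 hc).2, by rw [hb]; rfl, by simp at hlen ⊢; omega, hnd.of_cons⟩, ?_⟩
    rcases rest with _ | ⟨c, rest⟩
    · trivial
    · show c.1 = b.1
      by_contra hne
      have hbc : fisherGraph.Adj b c := (List.isChain_cons_cons.1 (List.isChain_cons_cons.1 hc).2).1
      have : c = a := by rw [eq_ext_of_adj hbc hne, hb, ext_ext]
      subst this
      exact (List.nodup_cons.1 hnd).1 (by simp)
  calc (sawFin p N).card ≤ _ := card_le_card hsub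
    _ ≤ (Aw p N).card + ((Aw (ext p) (N - 1)).image (List.cons p)).card := card_union_le _ _
    _ ≤ _ := add_le_add le_rfl card_image_le

end FV

/-! ### The upper bound, IV: assembly -/

section UpperGF

/-- Shifting an index costs a factor `1 + x`. [folklore] -/
private theorem sum_shift_le {f : ℕ → ℝ} (hf : ∀ n, 0 ≤ f n) {x : ℝ} (hx0 : 0 ≤ x) (L : ℕ) :
    ∑ N ∈ range (L + 1), f (N - 1) * x ^ N ≤ (1 + x) * ∑ N ∈ range (L + 1), f N * x ^ N := by
  rw [sum_range_succ' (fun N => f (N - 1) * x ^ N)]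
  simp only [Nat.add_sub_cancel, pow_zero, mul_one, Nat.zero_sub]
  have hS : 0 ≤ ∑ N ∈ range (L + 1), f N * x ^ N := sum_nonneg fun N _ => mul_nonneg (hf N) (pow_nonneg hx0 N)
  have h1 : ∑ N ∈ range L, f N * x ^ (N + 1) ≤ x * ∑ N ∈ range (L + 1), f N * x ^ N := by
    rw [mul_sum]
    calc ∑ N ∈ range L, f N * x ^ (N + 1) = ∑ N ∈ range L, x * (f N * x ^ N) :=
          sum_congr rfl fun N _ => by ring
      _ ≤ ∑ N ∈ range (L + 1), x * (f N * x ^ N) :=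
          sum_le_sum_of_subset_of_nonneg (range_subset_range.2 (Nat.le_succ L)) fun N _ _ =>
            mul_nonneg hx0 (mul_nonneg (hf N) (pow_nonneg hx0 N))
  have h2 : f 0 ≤ ∑ N ∈ range (L + 1), f N * x ^ N := by
    have : f 0 = f 0 * x ^ 0 := by simp
    rw [this]
    exact single_le_sum (f := fun N => f N * x ^ N) (fun N _ => mul_nonneg (hf N) (pow_nonneg hx0 N))
      (mem_range.2 (Nat.succ_pos L))
  linarith

/-- Partial sums of the hexagonal generating function are bounded below `1/μ(ℍ)`. [folklore] -/
private theorem exists_hexGF_bound {y : ℝ} (hy0 : 0 < y) (hlt : y < hexConnectiveConstant⁻¹) :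
    ∃ K : ℝ, ∀ M', ∑ n ∈ range M', (hexSawCount n : ℝ) * y ^ n ≤ K := by
  have hμ0 : 0 < hexConnectiveConstant := hexConnectiveConstant_pos
  have hμy : hexConnectiveConstant * y < 1 := by
    have := mul_lt_mul_of_pos_left hlt hμ0
    rwa [mul_inv_cancel₀ hμ0.ne'] at this
  set ρ := (hexConnectiveConstant * y + 1) / 2 with hρ
  have hρ1 : ρ < 1 := by rw [hρ]; linarith
  have hρ0 : 0 < ρ := by rw [hρ]; positivity
  have hμρ : hexConnectiveConstant < ρ / y := by rw [lt_div_iff₀ hy0, hρ]; linarith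
  obtain ⟨N₀, hN₀⟩ := eventually_atTop.1 ((tendsto_order.1 tendsto_hexSawCount_rpow).2 _ hμρ)
  have htail : ∀ n, N₀ ≤ n → 1 ≤ n → (hexSawCount n : ℝ) * y ^ n ≤ ρ ^ n := by
    intro n hn hn1
    have h := hN₀ n hn
    have hc : (0 : ℝ) ≤ hexSawCount n := Nat.cast_nonneg _
    have h1 : (hexSawCount n : ℝ) = ((hexSawCount n : ℝ) ^ (1 / (n : ℝ))) ^ n := by
      rw [one_div, Real.rpow_inv_natCast_pow hc (by omega)]
    have h2 : ((hexSawCount n : ℝ) ^ (1 / (n : ℝ))) ^ n ≤ (ρ / y) ^ n :=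
      pow_le_pow_left₀ (Real.rpow_nonneg hc _) h.le n
    calc (hexSawCount n : ℝ) * y ^ n ≤ (ρ / y) ^ n * y ^ n := by
          rw [h1]; exact mul_le_mul_of_nonneg_right h2 (pow_nonneg hy0.le n)
      _ = ρ ^ n := by rw [← mul_pow, div_mul_cancel₀ _ hy0.ne']
  refine ⟨∑ n ∈ range (N₀ + 1), (hexSawCount n : ℝ) * y ^ n + 1 / (1 - ρ), fun M' => ?_⟩
  have hsplit : ∑ n ∈ range M', (hexSawCount n : ℝ) * y ^ n ≤
      ∑ n ∈ range (N₀ + 1), (hexSawCount n : ℝ) * y ^ n + ∑ n ∈ range M', ρ ^ n := by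
    rw [← sum_filter_add_sum_filter_not (range M') (fun n => n ≤ N₀)]
    refine add_le_add ?_ ?_
    · refine sum_le_sum_of_subset_of_nonneg ?_ fun n _ _ => by positivity
      intro n hn
      rw [mem_filter, mem_range] at hn
      rw [mem_range]; omega
    · calc ∑ n ∈ (range M').filter (fun n => ¬ n ≤ N₀), (hexSawCount n : ℝ) * y ^ n
          ≤ ∑ n ∈ (range M').filter (fun n => ¬ n ≤ N₀), ρ ^ n :=
            sum_le_sum fun n hn => by
              rw [mem_filter] at hn
              exact htail n (by omega) (by omega)
        _ ≤ ∑ n ∈ range M', ρ ^ n :=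
            sum_le_sum_of_subset_of_nonneg (filter_subset _ _) fun n _ _ => pow_nonneg hρ0.le n
  have hgeom : ∑ n ∈ range M', ρ ^ n ≤ 1 / (1 - ρ) := by
    rw [geom_sum_eq hρ1.ne]
    have h1ρ : 0 < 1 - ρ := by linarith
    rw [show (ρ ^ M' - 1) / (ρ - 1) = (1 - ρ ^ M') / (1 - ρ) by
      rw [show ρ ^ M' - 1 = -(1 - ρ ^ M') by ring, show ρ - 1 = -(1 - ρ) by ring, neg_div_neg_eq],
      div_le_div_iff_of_pos_right h1ρ]
    linarith [pow_nonneg hρ0.le M']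
  linarith

/-- The A-walk generating function from any root is dominated by the hexagonal one. [folklore] -/
private theorem sum_Aw_le {x : ℝ} (hx0 : 0 ≤ x) (q : FV) (L : ℕ) :
    ∑ N ∈ range (L + 1), ((FV.Aw q N).card : ℝ) * x ^ N ≤
      (4 + 3 * x) * ((1 + 2 * x + 4 * x ^ 2) *
        ∑ n ∈ range (L + 1), (hexSawCount n : ℝ) * (x ^ 2 * (1 + x)) ^ n) := by
  classical
  set G := ∑ N ∈ range (L + 1), ((FV.goodA q ∅ N).card : ℝ) * x ^ N with hG
  have hG0 : 0 ≤ G := sum_nonneg fun N _ => by positivity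
  have h1 : ∑ N ∈ range (L + 1), ((FV.Aw q N).card : ℝ) * x ^ N ≤ G + 3 * ((1 + x) * G) := by
    calc ∑ N ∈ range (L + 1), ((FV.Aw q N).card : ℝ) * x ^ N
        ≤ ∑ N ∈ range (L + 1), (((FV.goodA q ∅ N).card : ℝ) * x ^ N +
            3 * (((FV.goodA q ∅ (N - 1)).card : ℝ) * x ^ N)) := sum_le_sum fun N _ => by
          have h := FV.card_Aw_le q N
          have h' : ((FV.Aw q N).card : ℝ) ≤ ((FV.goodA q ∅ N).card : ℝ) + 3 * ((FV.goodA q ∅ (N - 1)).card : ℝ) := by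
            exact_mod_cast h
          nlinarith [pow_nonneg hx0 N]
      _ = G + 3 * ∑ N ∈ range (L + 1), ((FV.goodA q ∅ (N - 1)).card : ℝ) * x ^ N := by
          rw [sum_add_distrib, ← mul_sum]
      _ ≤ G + 3 * ((1 + x) * G) := add_le_add le_rfl (mul_le_mul_of_nonneg_left
          (sum_shift_le (f := fun N => ((FV.goodA q ∅ N).card : ℝ)) (fun _ => Nat.cast_nonneg _) hx0 L)
          (by norm_num))
  have h2 : G ≤ (1 + 2 * x + 4 * x ^ 2) * ∑ n ∈ range (L + 1), (hexSawCount n : ℝ) * (x ^ 2 * (1 + x)) ^ n := by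
    have h := FV.gf_goodA_le hx0 L q.1 q.2 ∅ (Finset.notMem_empty _)
    have heq : ∀ n, ((HV.hgood q.1 ∅ n).card : ℝ) = hexSawCount n := fun n => by
      rw [HV.hgood_empty, card_sawFin_eq, ← hexSawCount_eq_card]
    simp only [heq, Prod.mk.eta] at h
    exact h
  have hH0 : 0 ≤ ∑ n ∈ range (L + 1), (hexSawCount n : ℝ) * (x ^ 2 * (1 + x)) ^ n :=
    sum_nonneg fun n _ => by positivity
  calc ∑ N ∈ range (L + 1), ((FV.Aw q N).card : ℝ) * x ^ N ≤ G + 3 * ((1 + x) * G) := h1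
    _ = (4 + 3 * x) * G := by ring
    _ ≤ _ := mul_le_mul_of_nonneg_left h2 (by positivity)

/-- **Upper bound** (the other half of Grimmett–Li 2013, Theorem 1(a), for `G = ℍ`): if `x > 0`
and `x²(1+x) < 1/μ(ℍ)` then `μ(F(ℍ)) ≤ 1/x`. [cite: GrimmettLi2013Fisher, Theorem 1(a), §4 eq. (4.4)] -/
theorem fisherConnectiveConstant_le_inv {x : ℝ} (hx0 : 0 < x)
    (hlt : x ^ 2 * (1 + x) < hexConnectiveConstant⁻¹) : fisherConnectiveConstant ≤ x⁻¹ := by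
  classical
  refine le_of_not_gt fun hgt => ?_
  set μF := fisherConnectiveConstant with hμF
  have hμx : 1 < μF * x := by
    have := mul_lt_mul_of_pos_right hgt hx0
    rwa [inv_mul_cancel₀ hx0.ne'] at this
  have hy0 : 0 < x ^ 2 * (1 + x) := by positivity
  obtain ⟨K, hK⟩ := exists_hexGF_bound hy0 hlt
  set C := (2 + x) * ((4 + 3 * x) * ((1 + 2 * x + 4 * x ^ 2) * K)) with hC
  -- uniform bound on the partial sums of the Fisher generating function
  have hbound : ∀ L, ∑ N ∈ range (L + 1), (fisherSawCount N : ℝ) * x ^ N ≤ C := by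
    intro L
    have hA := sum_Aw_le hx0.le fRoot L
    have hB := sum_Aw_le hx0.le (FV.ext fRoot) L
    have hKL := hK (L + 1)
    have hstep : ∑ N ∈ range (L + 1), (fisherSawCount N : ℝ) * x ^ N ≤
        ∑ N ∈ range (L + 1), ((FV.Aw fRoot N).card : ℝ) * x ^ N +
          (1 + x) * ∑ N ∈ range (L + 1), ((FV.Aw (FV.ext fRoot) N).card : ℝ) * x ^ N := by
      calc ∑ N ∈ range (L + 1), (fisherSawCount N : ℝ) * x ^ N
          ≤ ∑ N ∈ range (L + 1), (((FV.Aw fRoot N).card : ℝ) * x ^ N +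
              ((FV.Aw (FV.ext fRoot) (N - 1)).card : ℝ) * x ^ N) := sum_le_sum fun N _ => by
            have h : ((fisherSawCount N : ℕ) : ℝ) ≤ ((FV.Aw fRoot N).card : ℝ) + ((FV.Aw (FV.ext fRoot) (N - 1)).card : ℝ) := by
              exact_mod_cast FV.card_sawFin_le_Aw fRoot N
            nlinarith [pow_nonneg hx0.le N]
        _ ≤ _ := by
            rw [sum_add_distrib]
            exact add_le_add le_rfl (sum_shift_le (f := fun N => ((FV.Aw (FV.ext fRoot) N).card : ℝ))
              (fun _ => Nat.cast_nonneg _) hx0.le L)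
    have hB' := mul_le_mul_of_nonneg_left hB (by positivity : (0 : ℝ) ≤ 1 + x)
    have hprod : (2 + x) * ((4 + 3 * x) * ((1 + 2 * x + 4 * x ^ 2) *
        ∑ n ∈ range (L + 1), (hexSawCount n : ℝ) * (x ^ 2 * (1 + x)) ^ n)) ≤
        (2 + x) * ((4 + 3 * x) * ((1 + 2 * x + 4 * x ^ 2) * K)) :=
      mul_le_mul_of_nonneg_left (mul_le_mul_of_nonneg_left (mul_le_mul_of_nonneg_left hKL
        (by positivity)) (by positivity)) (by positivity)
    rw [hC]
    linarith [hA, hB', hstep, hprod]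
  -- but `(μ_F x)^L ≤ c_L x^L ≤ C`, contradicting `μ_F x > 1`
  obtain ⟨L, hL⟩ := (tendsto_pow_atTop_atTop_of_one_lt hμx).eventually_gt_atTop C |>.exists
  have h1 : (μF * x) ^ L ≤ (fisherSawCount L : ℝ) * x ^ L := by
    rw [mul_pow]; exact mul_le_mul_of_nonneg_right (fisherConnectiveConstant_pow_le L) (pow_nonneg hx0.le L)
  have h2 : (fisherSawCount L : ℝ) * x ^ L ≤ ∑ N ∈ range (L + 1), (fisherSawCount N : ℝ) * x ^ N :=
    single_le_sum (f := fun N => (fisherSawCount N : ℝ) * x ^ N) (fun N _ => by positivity)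
      (mem_range.2 (Nat.lt_succ_self L))
  linarith [hbound L]

end UpperGF

/-! ### The Fisher relation `g(1/μ(F)) = 1/μ(ℍ)` -/

section Relation

/-- **Grimmett–Li 2013, Theorem 1(a), for the hexagonal lattice** (`μ₁⁻¹ = g(μ₂⁻¹)` with
`g(z) = z² + z³`, `G₁ = ℍ`, `G₂ = F(ℍ)` its Fisher graph): `μ(F)⁻² (1 + μ(F)⁻¹) = μ(ℍ)⁻¹`.
[cite: GrimmettLi2013Fisher, Theorem 1(a)] -/
theorem fisher_relation :
    fisherConnectiveConstant⁻¹ ^ 2 * (1 + fisherConnectiveConstant⁻¹) = hexConnectiveConstant⁻¹ := by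
  have hμ0 : 0 < fisherConnectiveConstant := fisherConnectiveConstant_pos
  have ht0 : 0 < fisherConnectiveConstant⁻¹ := inv_pos.2 hμ0
  have hcont : Continuous fun x : ℝ => x ^ 2 * (1 + x) := by continuity
  rcases lt_trichotomy (fisherConnectiveConstant⁻¹ ^ 2 * (1 + fisherConnectiveConstant⁻¹))
    hexConnectiveConstant⁻¹ with hlt | heq | hgt
  · exfalso
    have hev : ∀ᶠ x in 𝓝[>] fisherConnectiveConstant⁻¹,
        x ^ 2 * (1 + x) < hexConnectiveConstant⁻¹ ∧ fisherConnectiveConstant⁻¹ < x :=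
      (((hcont.tendsto _).eventually (Iio_mem_nhds hlt)).filter_mono nhdsWithin_le_nhds).and
        (eventually_nhdsWithin_of_forall fun x hx => hx)
    obtain ⟨x, hgx, htx⟩ := hev.exists
    have hx0 : 0 < x := ht0.trans htx
    have h := fisherConnectiveConstant_le_inv hx0 hgx
    have h' : x⁻¹ < fisherConnectiveConstant := by
      have := inv_strictAnti₀ ht0 htx
      rwa [inv_inv] at this
    linarith
  · exact heq
  · exfalso
    have hev : ∀ᶠ x in 𝓝[<] fisherConnectiveConstant⁻¹,
        (hexConnectiveConstant⁻¹ < x ^ 2 * (1 + x) ∧ 0 < x) ∧ x < fisherConnectiveConstant⁻¹ :=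
      ((((hcont.tendsto _).eventually (Ioi_mem_nhds hgt)).and (eventually_gt_nhds ht0)).filter_mono
        nhdsWithin_le_nhds).and (eventually_nhdsWithin_of_forall fun x hx => hx)
    obtain ⟨x, ⟨hgx, hx0⟩, htx⟩ := hev.exists
    have h := inv_le_fisherConnectiveConstant hx0 hgx.le
    have h' : fisherConnectiveConstant < x⁻¹ := by
      have := inv_strictAnti₀ hx0 htx
      rwa [inv_inv] at this
    linarith

/-- The same in the form `x² + x³ = 1/μ(ℍ)` for `x = 1/μ(F)`. [cite: GrimmettLi2013Fisher, Theorem 1(a)] -/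
theorem fisher_relation' :
    fisherConnectiveConstant⁻¹ ^ 2 + fisherConnectiveConstant⁻¹ ^ 3 = hexConnectiveConstant⁻¹ := by
  rw [← fisher_relation]; ring

/-- **The connective constant of the Fisher lattice `(3·12²)`**: combining with
Duminil-Copin–Smirnov's `μ(ℍ) = √(2+√2)` (proved in the tree), `x = 1/μ(3·12²)` satisfies
`x² + x³ = 1/√(2+√2)`. [cite: GrimmettLi2013Fisher, Theorem 1(a)] [cite: DuminilCopinSmirnov2012, Thm 1] -/
theorem fisher_relation_sqrt :
    fisherConnectiveConstant⁻¹ ^ 2 + fisherConnectiveConstant⁻¹ ^ 3 = (Real.sqrt (2 + Real.sqrt 2))⁻¹ := by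
  rw [fisher_relation', hexConnectiveConstant_eq_of_thm1 DuminilCopinSmirnov2012_thm1_holds]

/-- Uniqueness: `1/μ(F)` is the unique positive root of `x² + x³ = 1/μ(ℍ)`. [cite: GrimmettLi2013Fisher, Theorem 1(a)] [cite: Lindorfer2018, §2 Example 2] -/
theorem inv_fisherConnectiveConstant_unique {x : ℝ} (hx0 : 0 < x)
    (hx : x ^ 2 + x ^ 3 = hexConnectiveConstant⁻¹) : x = fisherConnectiveConstant⁻¹ := by
  have ht0 : 0 < fisherConnectiveConstant⁻¹ := inv_pos.2 fisherConnectiveConstant_pos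
  have hrel := fisher_relation'
  have hmono : StrictMonoOn (fun t : ℝ => t ^ 2 + t ^ 3) (Set.Ioi 0) := by
    intro a ha b hb hab
    simp only [Set.mem_Ioi] at ha hb
    have : a ^ 2 < b ^ 2 := by nlinarith
    have : a ^ 3 < b ^ 3 := by nlinarith
    simp only; linarith
  exact hmono.injOn hx0 ht0 (hx.trans hrel.symm)

end Relation

/-! ### The printed vocabulary: the dart model `fisher hvGraph` of `F(ℍ) = (3,12²)` and the
connective constant in the sense of Grimmett–Li (2.1) -/

section PrintedVocabulary

variable {V : Type*}

/-- **The Fisher transformation `F(G)`** (Grimmett–Li 2013 §3: "acts on v by replacing it by a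
triangle"; "F(G) for the graph obtained from the cubic graph G by applying the Fisher
transformation at every vertex") on Mathlib's darts: the corner of `v`'s triangle on the edge
towards `w` is the dart `(v,w)`; `(v,w) ∼ (v,w')` (`w ≠ w'`, triangle edges) and `(v,w) ∼ (w,v)`
(inherited edge). A definition with a body (no axiom). [cite: GrimmettLi2013Fisher, §3] -/
def fisher (G : SimpleGraph V) : SimpleGraph G.Dart where
  Adj d e := (d.fst = e.fst ∧ d.snd ≠ e.snd) ∨ e = d.symm
  symm := ⟨fun d e h => by
    rcases h with ⟨h1, h2⟩ | h
    · exact Or.inl ⟨h1.symm, fun h' => h2 h'.symm⟩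
    · exact Or.inr (by rw [h, SimpleGraph.Dart.symm_symm])⟩
  loopless := ⟨fun d h => by
    rcases h with ⟨_, h⟩ | h
    · exact h rfl
    · exact d.symm_ne h.symm⟩

/-- Adjacency of `F(G)`, unfolded. [cite: GrimmettLi2013Fisher, §3] -/
theorem fisher_adj {G : SimpleGraph V} {d e : G.Dart} :
    (fisher G).Adj d e ↔ (d.fst = e.fst ∧ d.snd ≠ e.snd) ∨ e = d.symm := Iff.rfl

/-- "μ = lim_{n→∞} σ_n(v)^{1/n}, v ∈ V" (Grimmett–Li (2.1)): `μ` is the connective constant of `G`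
in the printed sense, from EVERY start (a predicate, not an assertion).
[cite: GrimmettLi2013Fisher, §2 eq. (2.1)] -/
def HasConnectiveConstant (G : SimpleGraph V) (μ : ℝ) : Prop :=
  ∀ v : V, Tendsto (fun n : ℕ => (sawCount G v n : ℝ) ^ (1 / (n : ℝ))) atTop (𝓝 μ)

namespace FV

/-- Corner `(u, k)` ↦ dart `(u, port u k)`. [folklore] -/
def toDart (p : FV) : hvGraph.Dart := ⟨(p.1, HV.port p.1 p.2), HV.adj_port p.1 p.2⟩

/-- Dart `(u, v)` ↦ corner `(u, pidx u v)`. [folklore] -/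
def ofDart (d : hvGraph.Dart) : FV := (d.fst, HV.pidx d.fst d.snd)

/-- First component of `toDart`. [folklore] -/
@[simp] private theorem toDart_fst (p : FV) : (toDart p).fst = p.1 := rfl

/-- Second component of `toDart`. [folklore] -/
@[simp] private theorem toDart_snd (p : FV) : (toDart p).snd = HV.port p.1 p.2 := rfl

/-- `ofDart ∘ toDart = id`. [folklore] -/
private theorem ofDart_toDart (p : FV) : ofDart (toDart p) = p := by
  obtain ⟨u, k⟩ := p
  simp [ofDart, HV.pidx_port]

/-- `toDart ∘ ofDart = id`. [folklore] -/
private theorem toDart_ofDart (d : hvGraph.Dart) : toDart (ofDart d) = d := by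
  rw [SimpleGraph.Dart.ext_iff]
  exact Prod.ext rfl (HV.port_pidx d.adj)

/-- The corner/dart bijection. [folklore] -/
def dartEquiv : FV ≃ hvGraph.Dart := ⟨toDart, ofDart, ofDart_toDart, toDart_ofDart⟩

/-- **The port model and the dart model of `F(ℍ) = (3,12²)` are isomorphic graphs.** [folklore] -/
def fisherIso : fisherGraph ≃g fisher hvGraph where
  toEquiv := dartEquiv
  map_rel_iff' := by
    rintro ⟨u, k⟩ ⟨u', k'⟩
    change (fisher hvGraph).Adj (toDart (u, k)) (toDart (u', k')) ↔ fisherGraph.Adj (u, k) (u', k')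
    rw [fisher_adj, fisherGraph_adj, FV.AdjRel, toDart_fst, toDart_fst, toDart_snd, toDart_snd]
    simp only
    constructor
    · rintro (⟨rfl, hne⟩ | h)
      · exact Or.inl ⟨rfl, fun hk => hne (by rw [hk])⟩
      · rw [SimpleGraph.Dart.ext_iff] at h
        have h1 : u' = HV.port u k := congrArg Prod.fst h
        have h2 : HV.port u' k' = u := congrArg Prod.snd h
        refine Or.inr ⟨h1, ?_⟩
        apply HV.port_injective u'
        rw [h2, h1, HV.port_port]
    · rintro (⟨rfl, hk⟩ | ⟨h1, h2⟩)
      · exact Or.inl ⟨rfl, fun h => hk (HV.port_injective u h)⟩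
      · right
        rw [SimpleGraph.Dart.ext_iff]
        change (u', HV.port u' k') = (HV.port u k, u)
        rw [h1, h2, HV.port_port]

/-- `fisherIso` on corners is `toDart`. [folklore] -/
private theorem fisherIso_apply (p : FV) : fisherIso p = toDart p := rfl

end FV

/-- `c_N` of the port model from any corner is `fisherSawCount N`. [cite: GrimmettLi2013Fisher, §2 eq. (2.1)] -/
theorem sawCount_fisherGraph (p : FV) (N : ℕ) : sawCount fisherGraph p N = fisherSawCount N := by
  rw [sawCount_eq_ncard_sawLists, FV.ncard_sawLists_eq_card_sawFin, FV.card_sawFin_eq, fisherSawCount]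

/-- `σ_N(d)` of the dart model `F(ℍ)` from any dart is `fisherSawCount N`. [cite: GrimmettLi2013Fisher, §2 eq. (2.1)] -/
theorem sawCount_fisher_hvGraph (d : hvGraph.Dart) (N : ℕ) :
    sawCount (fisher hvGraph) d N = fisherSawCount N := by
  rw [← FV.toDart_ofDart d, ← FV.fisherIso_apply, sawCount_iso, sawCount_fisherGraph]

/-- `μ(F(ℍ))` is the connective constant of the dart model `fisher hvGraph` in the printed sense
(2.1), from every dart. [cite: GrimmettLi2013Fisher, §2 eq. (2.1)] -/
theorem fisher_hvGraph_hasConnectiveConstant :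
    HasConnectiveConstant (fisher hvGraph) fisherConnectiveConstant := by
  intro d
  refine tendsto_fisherSawCount_rpow.congr' (Eventually.of_forall fun n => ?_)
  simp only [sawCount_fisher_hvGraph]

/-- The connective constant in the sense (2.1) is unique. [cite: GrimmettLi2013Fisher, §2 eq. (2.1)] -/
theorem HasConnectiveConstant.unique {G : SimpleGraph V} {μ μ' : ℝ} (v : V)
    (h : HasConnectiveConstant G μ) (h' : HasConnectiveConstant G μ') : μ = μ' :=
  tendsto_nhds_unique (h v) (h' v)

/-- **Grimmett–Li 2013, Theorem 1(a) at `G = ℍ`, `k = 0`, in the printed vocabulary**: the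
connective constant `μ(𝔸)` of the `(3,12²)` lattice `F(ℍ)` exists in the sense (2.1) (from every
start) and "1/μ(𝔸)² + 1/μ(𝔸)³ = 1/μ(ℍ)" (Lindorfer 2018 (2.16)) `= 1/√(2+√2)`
(Duminil-Copin–Smirnov's `μ(ℍ) = √(2+√2)`, proved in the tree). [cite: GrimmettLi2013Fisher, Theorem 1(a)] [cite: DuminilCopinSmirnov2012, Thm 1] [cite: Lindorfer2018, §2 Example 2 eq. (2.16)] -/
theorem exists_hasConnectiveConstant_fisher_hvGraph :
    ∃ μA : ℝ, 0 < μA ∧ HasConnectiveConstant (fisher hvGraph) μA ∧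
      μA⁻¹ ^ 2 + μA⁻¹ ^ 3 = (Real.sqrt (2 + Real.sqrt 2))⁻¹ :=
  ⟨fisherConnectiveConstant, fisherConnectiveConstant_pos, fisher_hvGraph_hasConnectiveConstant,
    fisher_relation_sqrt⟩

/-- … and the witness is unique: any connective constant of `F(ℍ)` in the sense (2.1) equals
`fisherConnectiveConstant`, the unique positive root of `x⁻² + x⁻³ = 1/μ(ℍ)`. [cite: GrimmettLi2013Fisher, §2 eq. (2.1)] -/
theorem HasConnectiveConstant.eq_fisherConnectiveConstant {μA : ℝ} (h : HasConnectiveConstant (fisher hvGraph) μA) :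
    μA = fisherConnectiveConstant :=
  h.unique (FV.toDart fRoot) fisher_hvGraph_hasConnectiveConstant

end PrintedVocabulary

/-! ### Numbers: a kernel-certified enclosure of `μ(3·12²)` -/

section Numbers

/-- `1.8477590 < √(2+√2) < 1.8477591`. [folklore] -/
private theorem sqrt_two_add_sqrt_two_bounds :
    (1.8477590 : ℝ) < Real.sqrt (2 + Real.sqrt 2) ∧ Real.sqrt (2 + Real.sqrt 2) < 1.8477591 := by
  have h2lo : (1.41421356 : ℝ) < Real.sqrt 2 := by
    rw [Real.lt_sqrt (by norm_num)]; norm_num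
  have h2hi : Real.sqrt 2 < 1.41421357 := by
    rw [Real.sqrt_lt' (by norm_num)]; norm_num
  constructor
  · rw [Real.lt_sqrt (by norm_num)]; nlinarith
  · rw [Real.sqrt_lt' (by norm_num)]; nlinarith

/-- Every positive solution of `μ⁻² + μ⁻³ = (2+√2)^{-1/2}` satisfies `1.711041 < μ < 1.7110414`.
[folklore] -/
private theorem value_enclosure {μ : ℝ} (hμ : 0 < μ)
    (e : μ⁻¹ ^ 2 + μ⁻¹ ^ 3 = (Real.sqrt (2 + Real.sqrt 2))⁻¹) :
    (1.711041 : ℝ) < μ ∧ μ < 1.7110414 := by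
  obtain ⟨hlo, hhi⟩ := sqrt_two_add_sqrt_two_bounds
  have hs : 0 < Real.sqrt (2 + Real.sqrt 2) := lt_trans (by norm_num) hlo
  have hc_lo : (1.8477591 : ℝ)⁻¹ < (Real.sqrt (2 + Real.sqrt 2))⁻¹ := (inv_lt_inv₀ (by norm_num) hs).2 hhi
  have hc_hi : (Real.sqrt (2 + Real.sqrt 2))⁻¹ < (1.8477590 : ℝ)⁻¹ := (inv_lt_inv₀ hs (by norm_num)).2 hlo
  set x : ℝ := μ⁻¹ with hx
  have hxpos : 0 < x := inv_pos.2 hμ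
  have hx_lo : (0.5844394 : ℝ) < x := by
    by_contra h
    rw [not_lt] at h
    have h2 : x ^ 2 ≤ (0.5844394 : ℝ) ^ 2 := pow_le_pow_left₀ hxpos.le h 2
    have h3 : x ^ 3 ≤ (0.5844394 : ℝ) ^ 3 := pow_le_pow_left₀ hxpos.le h 3
    have hnum : (0.5844394 : ℝ) ^ 2 + 0.5844394 ^ 3 < (1.8477591 : ℝ)⁻¹ := by norm_num
    linarith
  have hx_hi : x < 0.5844395 := by
    by_contra h
    rw [not_lt] at h
    have h2 : (0.5844395 : ℝ) ^ 2 ≤ x ^ 2 := pow_le_pow_left₀ (by norm_num) h 2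
    have h3 : (0.5844395 : ℝ) ^ 3 ≤ x ^ 3 := pow_le_pow_left₀ (by norm_num) h 3
    have hnum : (1.8477590 : ℝ)⁻¹ < (0.5844395 : ℝ) ^ 2 + 0.5844395 ^ 3 := by norm_num
    linarith
  have hμx : μ = x⁻¹ := by rw [hx, inv_inv]
  constructor
  · rw [hμx]
    calc (1.711041 : ℝ) < (0.5844395 : ℝ)⁻¹ := by norm_num
      _ < x⁻¹ := (inv_lt_inv₀ (by norm_num) hxpos).2 hx_hi
  · rw [hμx]
    calc x⁻¹ < (0.5844394 : ℝ)⁻¹ := (inv_lt_inv₀ hxpos (by norm_num)).2 hx_lo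
      _ < 1.7110414 := by norm_num

/-- **`1.711041 < μ(3·12²) < 1.7110414`** — a certified enclosure of the printed value
"μ(𝔸) ≈ 1.711041" (Lindorfer 2018, Example 2). [cite: Lindorfer2018, §2 Example 2] -/
theorem fisherConnectiveConstant_bounds :
    (1.711041 : ℝ) < fisherConnectiveConstant ∧ fisherConnectiveConstant < 1.7110414 :=
  value_enclosure fisherConnectiveConstant_pos fisher_relation_sqrt

end Numbers

end Literature.Probability.RandomPlanarGeometry.SAW
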